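import Literature.MathematicalPhysics.QuantumFieldTheory.Balaban1983to89.T4RecentScale
import Literature.MathematicalPhysics.QuantumFieldTheory.Balaban1983to89.T4WeightBudget
import Literature.MathematicalPhysics.QuantumFieldTheory.Balaban1983to89.T4IndicatorShell

/-!
# `Balaban1983to89.T4GoodClassBudget` — the RECENT-SCALE GOOD-CLASS BUDGET `R_τ + s_τ ≤ vol·δ_K` of the uniqueness
spine (cell `pub-balaban`, T4-DAG v4/v5 §5 row T4-U5.E-b, nodes U5/U5b; kernel bookkeeping over `T4RecentScale`,
`T4Crossover`, `T4WeightBudget`, `T4IndicatorShell`; record `t4/T4-EST-U5E-b.md`; v1.1 = v1 (p181187) + §3b)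

HONEST FRAMING (cell `pub-balaban`, T4-DAG PAGE 1).  The cell's T4 target is the existence AND uniqueness of the
continuum limit of Bałaban's unit-scale averaged loop expectations on a finite torus — strictly beyond ultraviolet
stability ([Balaban1989LargeFieldII] Thm 1 p. 355); it is NOT the Yang–Mills mass gap and NOT the Clay problem.  This module
is the KERNEL part of ONE row (T4-U5.E-b): the third (b) of the assembly hypothesis of node U5.E, namely the `hgood` clause
of `T4WeightBudget.hybridSandwich_of_relWeightBound` — "on the GOOD class every term of run B is sandwiched against the
paired term of run A with ONE t-independent constant `c_K` and radius `vol·δ_K`, `Σ_K δ_K < ∞`".  NOTHING of Bałaban's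
estimates is proved here.  What is kernel-checked is real-number bookkeeping: how per-slice SIZE and RATE bounds with
DIFFERENT centres combine to `min(SIZE, RATE)` (§1), how slice sums become per-unit-volume budgets of the shape of
`T4Crossover.crossoverDelta` (§2, minimum form) or of the PRODUCT form rate × size (§2, `SliceRateSize`), how rate-shaped
per-degree-of-freedom deviations confined to the RECENT window `j⋆(K) ≤ j ≤ K` sum to `vol ×` a WINDOW SUM
`Σ_{j=j⋆}^{K} θ^j Λ^{K−j}` which is summable in `K` once `K − j⋆(K) ≤ σK + 1` with `θ(Λ/θ)^σ < 1` (§3 — and ONE cut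
`j⋆(K) = K − ⌈σK⌉` serves both this window and the `c·K ≤ K − j⋆(K)` input of `T4WeightBudget.summable_weightMajorant`;
§3b, v1.1 — the LOGARITHMIC cut `jlog(K) = K − ⌈C·log(K+1)⌉` does better: the bad-class weight `V·r^{K − jlog(K)}` is a
p-series (`summable_weightMajorant_log`, `C·(−log r) > 1`), the window's trivial count is POLYNOMIAL in `K`, the θ-window
sum is summable for EVERY `θ < 1`, and a per-cube discrepancy that is only polynomially small in `K` is budgeted by
trivial counting (`summable_polyRate_logWindow`) — the arithmetic behind objection §R3 of the record),
the boundary-term rate entering BY NAME as the hypothesis `BoundaryRate` (= row T4-U3.B's deliverable, §4), Markov caps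
on history functionals (§5: the relative weight of the terms where a nonnegative functional exceeds `vol·v` is at most
`ν/v` under a first-moment hypothesis `FirstMoment` — the located repair of §R of the record), and the packaging of
per-term budgets into the literal `hgood` clause and the `T4WeightBudget` consumers (§6).  Every cell estimate enters as a
HYPOTHESIS SHAPE (`def … : Prop`, labelled NOT PRINTED), never as a fact.

CITATION HEADER (quotations read from the rendered pages of the cell's page store, `b2b-balaban-ref1/pages/…`, as images).
* [Balaban1988Convergent] T. Bałaban, *Convergent renormalization expansions for lattice gauge theories*, Commun. Math.
  Phys. 119 (1988) 243–285: (2.40)–(2.42) p. 261, p. 262 (constants `E_k`; alternative boundary assumptions), Theorem 2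
  (2.43)–(2.44) p. 263, (2.47)–(2.49) p. 264.
* [Balaban1989LargeFieldII] T. Bałaban, *Large field renormalization. II. Localization, exponentiation, and bounds for the
  R operation*, Commun. Math. Phys. 122 (1989) 355–392: p. 380 (normalization constants `O(log g_j^{−2})`), (1.98)–(1.101)
  p. 390 (new boundary terms `𝐁′^{(k)}(X)`, `c₁ = exp(−p₀(g_k))`).
* [Balaban1987RG1] only through the docstring of `T4RecentScale.Multiplicity` ((0.26) p. 257: sums over localization
  domains through a cube).

PRINTED CONTEXT (what print says near the objects typed here; ONE run, fixed lattice spacing; none of it is a two-run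
statement).  (a) The constants are term- and run-dependent: p. 262 «The constant E_k (depending on {Ω_j}, {Λ_j} also) is
obtained by subtracting one-step vacuum energy expressions, generated in small field regions, from the initial constant E.»;
p. 264 «Finally, the vacuum energy counterterm E_k, except the terms logarithmic in coupling constants, has the same bound as
above, only with a different constant.», with (2.49) «A_k(1/g_k², U_k) = −A(1/g_k², U_k) + (the logarithmic terms) + O(1)
Σ_{j=1}^k |Γ_j|» and «The first term on the right-hand side yields the small factors for large field characteristic
functions. It also controls the logarithmic terms.»; [Balaban1989LargeFieldII] p. 380 «Similar bounds hold for vacuum energy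
counterterms and normalization constants, except that for the last we have the corresponding constant O(log g_j^{−2}) instead
of O(1).»  (b) The printed SIZE bounds carry large-field volumes: Theorem 2 p. 263, (2.43) `|Σ_{z∈Λ_j^0∩Ω}[𝐄^{(j)}(Λ_j,
U_k, z) − 𝐄^{(j)}(Λ_j, 1, z)] − β_j(g_{j−1})A(φ, U_k)| ≦ E_1 Σ_{n=j}^{k} (L^{j−n})^β |Γ_n∩Ω|` «for β < 1, and sufficiently
regular configurations U_k = U_k(V), e.g. for V restricted by the characteristic functions in (2.18).», (2.44) `|Σ_{X∈𝐃_j,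
X⊂Λ_j, X∩Ω≠∅}[𝐑^{(j)}(X, U_k) − 𝐑^{(j)}(X, 1)]| ≦ R_1 g_j^{κ₀} Σ_{n=j}^{k} |Γ_n∩Ω|`, «The volumes are taken in the
corresponding scales, i.e. |Γ_n∩Ω| means the number of points in the set Γ_n∩Ω ⊂ T_1^{(n)}.», summed in (2.45) `|𝐄_k(U_k)|
≦ E_1 Σ_{n=1}^{k}|Γ_n| Σ_{j=1}^{n}(L^{j−n})^β < E_1(1 − L^{−β})^{−1} Σ_{n=1}^{k}|Γ_n|` and (2.46) «for κ₀ ≧ 7 and g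
sufficiently small.» — the all-regular part `n = k` is the SIZE branch of `T4Crossover.crossoverDelta` (`a = L^{−β}` per
scale, volume `vol` in unit-lattice points); the parts `n < k` (regions regular only to scale `n`) are NOT in that majorant
(record §R2, GAPS).  (c) Boundary terms: (2.41)–(2.42) p. 261 (sum over domains meeting both `Ω_j` and `Z_j^~`, analytic on
`Ũ_j^c(X, α̃₀, α̃₁)`, `|𝐁^{(j)}(X,…)| < B_0 exp(−κd_j(X))`), (2.47) p. 264 `|𝐁^{(j,n)}| ≤ B_1 2^{−(j−n)}|Γ_n|`, and
[Balaban1989LargeFieldII] (1.99) p. 390 `|𝐑′^{(k)}(X,(𝐔,𝐉))| ≤ O(1)c_1 exp(−(1 + ½β)κ d_{k,∪Y_i}(X))`, «The terms of the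
first group are new boundary terms, and they are denoted by 𝐁′^{(k)}(X).»

WHAT IS PROVED (all [folklore]: finite sums, `exp`/`log` monotonicity, `rpow` monotonicity, Markov's inequality for finite
nonnegative families, comparison of series) and WHAT IS ONLY TYPED (the shapes `RecentDeviation` = cell hazard H-U5b-1,
`BoundaryRate` = row T4-U3.B, `SliceRateSize` = cell NE5′, `FirstMoment` = cell NE7b′, `TermBudget`/`GoodClause` = the row's
output) is stated decl by decl.  Deliberately NOT here: any claim that Bałaban's expansions satisfy these shapes; the index
set of "terms" (interface condition I-2 of `t4/T4-EST-U5c.md`); the weight budget itself (`T4WeightBudget`, row T4-U5c.E).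
-/

open Finset _root_.Filter _root_.Topology

namespace Literature.MathematicalPhysics.QuantumFieldTheory.Balaban1983to89.T4GoodClassBudget

open T4HybridMatching T4CauchySum T4Crossover

/-! ## §1 Choice of centring: per slice, `min(SIZE, RATE)` is realised by CHOOSING the centre

`T4RecentScale.slice_le_min` takes the minimum of a SIZE bound and a RATE bound of the same centred slice.  In the cell's
ledger the two bounds are centred DIFFERENTLY: the SIZE bound (the shape of (2.43)/(2.44) p. 263, one run at a time) is
centred at the run's own field-independent value, the RATE bound (node U5b, `T4RecentScale.FactorLogRatio`) at the sum of
the factor constants `c_i`.  The honest combination: per slice pick the centre whose radius is smaller; the class constant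
`C_τ` is then the sum of the CHOSEN centres (still field- and t-independent), the remainder the sum of minima. [folklore] -/

/-- If `y` is within `S` of `κ₁` and within `ρ` of `κ₂`, it is within `min S ρ` of the centre chosen by comparing radii.
[folklore] -/
theorem abs_sub_ite_le_min {y κ₁ κ₂ S ρ : ℝ} (h₁ : |y - κ₁| ≤ S) (h₂ : |y - κ₂| ≤ ρ) :
    |y - (if S ≤ ρ then κ₁ else κ₂)| ≤ min S ρ := by
  split_ifs with h
  · rwa [min_eq_left h]
  · rwa [min_eq_right (not_le.mp h).le]

/-- The per-slice centre chosen by comparing the SIZE radius `S j` with the RATE radius `ρ j`. [folklore] -/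
noncomputable def sliceCentre (κ₁ κ₂ S ρ : ℕ → ℝ) (j : ℕ) : ℝ := if S j ≤ ρ j then κ₁ j else κ₂ j

/-- The chosen centre is within `min (S j) (ρ j)` of `y` when both centres bound it. [folklore] -/
theorem abs_sub_sliceCentre_le {κ₁ κ₂ S ρ : ℕ → ℝ} {j : ℕ} {y : ℝ} (h₁ : |y - κ₁ j| ≤ S j)
    (h₂ : |y - κ₂ j| ≤ ρ j) : |y - sliceCentre κ₁ κ₂ S ρ j| ≤ min (S j) (ρ j) := by
  unfold sliceCentre; exact abs_sub_ite_le_min h₁ h₂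

/-- SIZE CENTRING, two runs separately: if run A's slice value is within `S^A` of its own field-independent centre and run
B's within `S^B` of its own, the DIFFERENCE is within `S^A + S^B` of the difference of centres (the way the one-run bounds
(2.43)/(2.44) p. 263 of [Balaban1988Convergent] enter a two-run comparison). [folklore] -/
theorem size_centring {yA yB κA κB SA SB : ℝ} (hA : |yA - κA| ≤ SA) (hB : |yB - κB| ≤ SB) :
    |(yB - yA) - (κB - κA)| ≤ SA + SB := by
  have e : (yB - yA) - (κB - κA) = (yB - κB) - (yA - κA) := by ring
  rw [e]
  calc |(yB - κB) - (yA - κA)| ≤ |yB - κB| + |yA - κA| := abs_sub _ _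
    _ ≤ SB + SA := add_le_add hB hA
    _ = SA + SB := add_comm _ _

/-- RATE CENTRING, factorwise: a scale slice of factorwise bounds `|log f^B_i − log f^A_i − c_i| ≤ r_i` is within
`Σ_{slice} r_i` of the slice's rate centre `Σ_{slice} c_i`. [folklore] -/
theorem rate_centring {ι V : Type*} {fac : Finset ι} {fA fB : ι → V → ℝ} {sc : ι → ℕ} {c r : ι → ℝ} {v : V}
    (j : ℕ) (h : ∀ i ∈ fac, |Real.log (fB i v) - Real.log (fA i v) - c i| ≤ r i) :
    |(∑ i ∈ fac with sc i = j, (Real.log (fB i v) - Real.log (fA i v))) - ∑ i ∈ fac with sc i = j, c i|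
      ≤ ∑ i ∈ fac with sc i = j, r i := by
  rw [← Finset.sum_sub_distrib]
  exact (Finset.abs_sum_le_sum_abs _ _).trans
    (Finset.sum_le_sum fun i hi => h i (Finset.mem_filter.mp hi).1)

/-- LOG OF A PRODUCT AGAINST PER-SLICE CENTRES: all factors positive, creation scales in `t`, and each scale slice of
`log f^B − log f^A` within `R j` of a centre `κ j` ⇒ `log ∏ f^B − log ∏ f^A` is within `Σ_t R` of `Σ_t κ`. [folklore] -/
theorem abs_log_prod_sub_le_of_sliceCentres {ι V : Type*} {fac : Finset ι} {fA fB : ι → V → ℝ} {sc : ι → ℕ}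
    {t : Finset ℕ} {κ R : ℕ → ℝ} {v : V} (hsc : ∀ i ∈ fac, sc i ∈ t) (hA : ∀ i ∈ fac, 0 < fA i v)
    (hB : ∀ i ∈ fac, 0 < fB i v)
    (hR : ∀ j ∈ t, |(∑ i ∈ fac with sc i = j, (Real.log (fB i v) - Real.log (fA i v))) - κ j| ≤ R j) :
    |Real.log (∏ i ∈ fac, fB i v) - Real.log (∏ i ∈ fac, fA i v) - ∑ j ∈ t, κ j| ≤ ∑ j ∈ t, R j := by
  rw [Real.log_prod fun i hi => (hB i hi).ne', Real.log_prod fun i hi => (hA i hi).ne',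
    ← Finset.sum_sub_distrib,
    ← Finset.sum_fiberwise_of_maps_to hsc (fun i => Real.log (fB i v) - Real.log (fA i v)),
    ← Finset.sum_sub_distrib]
  exact (Finset.abs_sum_le_sum_abs _ _).trans (Finset.sum_le_sum hR)

/-- **THE CROSSOVER REMAINDER BY CHOICE OF CENTRING.**  If every scale slice is within the SIZE radius `S j` of a size
centre `κ₁ j` AND within the RATE radius `ρ j` of a rate centre `κ₂ j`, then `log ∏ f^B − log ∏ f^A` is within
`Σ_t min(S j, ρ j)` of the field-independent constant `Σ_t sliceCentre κ₁ κ₂ S ρ j`. [folklore] -/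
theorem abs_log_prod_sub_le_crossover {ι V : Type*} {fac : Finset ι} {fA fB : ι → V → ℝ} {sc : ι → ℕ}
    {t : Finset ℕ} {κ₁ κ₂ S ρ : ℕ → ℝ} {v : V} (hsc : ∀ i ∈ fac, sc i ∈ t) (hA : ∀ i ∈ fac, 0 < fA i v)
    (hB : ∀ i ∈ fac, 0 < fB i v)
    (hS : ∀ j ∈ t, |(∑ i ∈ fac with sc i = j, (Real.log (fB i v) - Real.log (fA i v))) - κ₁ j| ≤ S j)
    (hρ : ∀ j ∈ t, |(∑ i ∈ fac with sc i = j, (Real.log (fB i v) - Real.log (fA i v))) - κ₂ j| ≤ ρ j) :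
    |Real.log (∏ i ∈ fac, fB i v) - Real.log (∏ i ∈ fac, fA i v) - ∑ j ∈ t, sliceCentre κ₁ κ₂ S ρ j|
      ≤ ∑ j ∈ t, min (S j) (ρ j) :=
  abs_log_prod_sub_le_of_sliceCentres hsc hA hB fun j hj => abs_sub_sliceCentre_le (hS j hj) (hρ j hj)

/-- Two centred bounds add. [folklore] -/
theorem abs_sub_add_le {x₁ x₂ c₁ c₂ r₁ r₂ : ℝ} (h₁ : |x₁ - c₁| ≤ r₁) (h₂ : |x₂ - c₂| ≤ r₂) :
    |(x₁ + x₂) - (c₁ + c₂)| ≤ r₁ + r₂ := by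
  have e : (x₁ + x₂) - (c₁ + c₂) = (x₁ - c₁) + (x₂ - c₂) := by ring
  rw [e]; exact (abs_add_le _ _).trans (add_le_add h₁ h₂)

/-- GROUPS OF FACTORS (e.g. the crossover group of §1 and the window group of §3/§4): centred log-ratio bounds for the
products over two disjoint groups give the bound for the product over the union, centres and radii adding. [folklore] -/
theorem abs_log_prod_union_sub_le {ι V : Type*} [DecidableEq ι] {fac₁ fac₂ : Finset ι} {fA fB : ι → V → ℝ} {v : V}
    {c₁ c₂ r₁ r₂ : ℝ} (hdis : Disjoint fac₁ fac₂) (hA : ∀ i ∈ fac₁ ∪ fac₂, 0 < fA i v)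
    (hB : ∀ i ∈ fac₁ ∪ fac₂, 0 < fB i v)
    (h₁ : |Real.log (∏ i ∈ fac₁, fB i v) - Real.log (∏ i ∈ fac₁, fA i v) - c₁| ≤ r₁)
    (h₂ : |Real.log (∏ i ∈ fac₂, fB i v) - Real.log (∏ i ∈ fac₂, fA i v) - c₂| ≤ r₂) :
    |Real.log (∏ i ∈ fac₁ ∪ fac₂, fB i v) - Real.log (∏ i ∈ fac₁ ∪ fac₂, fA i v) - (c₁ + c₂)| ≤ r₁ + r₂ := by
  have pA : ∀ s, s ⊆ fac₁ ∪ fac₂ → ∏ i ∈ s, fA i v ≠ 0 := fun s hs =>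
    Finset.prod_ne_zero_iff.mpr fun i hi => (hA i (hs hi)).ne'
  have pB : ∀ s, s ⊆ fac₁ ∪ fac₂ → ∏ i ∈ s, fB i v ≠ 0 := fun s hs =>
    Finset.prod_ne_zero_iff.mpr fun i hi => (hB i (hs hi)).ne'
  rw [Finset.prod_union hdis, Finset.prod_union hdis,
    Real.log_mul (pB _ Finset.subset_union_left) (pB _ Finset.subset_union_right),
    Real.log_mul (pA _ Finset.subset_union_left) (pA _ Finset.subset_union_right)]
  have e : Real.log (∏ i ∈ fac₁, fB i v) + Real.log (∏ i ∈ fac₂, fB i v)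
      - (Real.log (∏ i ∈ fac₁, fA i v) + Real.log (∏ i ∈ fac₂, fA i v)) - (c₁ + c₂)
      = (Real.log (∏ i ∈ fac₁, fB i v) - Real.log (∏ i ∈ fac₁, fA i v) - c₁)
        + (Real.log (∏ i ∈ fac₂, fB i v) - Real.log (∏ i ∈ fac₂, fA i v) - c₂) := by ring
  rw [e]; exact (abs_add_le _ _).trans (add_le_add h₁ h₂)

/-! ## §2 Per-unit-volume budgets: the MINIMUM form (shape of `T4Crossover.crossoverDelta`) and the PRODUCT form

MINIMUM FORM (the row as drawn, T4-DAG v4 §5 T4-U5.E-b): per slice `j ≤ K` a SIZE radius `S_j ≤ vol·SZ_j` (`SZ_j` the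
all-regular per-unit-volume size, e.g. `E a^{K−j}`, `R₁ g_j^{κ₀}` — the `n = k` part of (2.43)/(2.44)) and a RATE radius
`ρ_j ≤ Cw·vol·C θ^j Λ^{K−j}` (node U5b's profile with the coupling discrepancy merged, `T4RecentScale.theta_add_delta_le`,
times `T4RecentScale.Multiplicity`); the sum of minima is `vol ×` the un-weighted branches of `crossoverDelta`.
PRODUCT FORM (`SliceRateSize`, cell NEW ESTIMATE NE5′, NOT PRINTED — the located repair of record §R2 for old slices
evaluated near RECENT pending large-field structures, where (2.43) carries the extra volumes `a^{n−j}|Γ_n ∩ Ω|`, `n < k`):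
per slice the remainder is RATE × SIZE, `θ^j·(vol·E·a^{K−j} + Σ_n [j ≤ n] a^{n−j} G_n)`; then `Σ_{j ≤ n} θ^j a^{n−j} ≤
(n+1)·max(θ,a)^n` makes the pending part a WINDOW SUM in `max(θ, a)` even with the trivial count `G_n ≤ vol·S·Λ^{K−n}`
(§3), and the regular part `(K+1)·max(θ,a)^K`. [folklore arithmetic; the shapes are hypotheses] -/

/-- A RATE slice under `T4RecentScale.Multiplicity`: `Σ_{sc i = j} C θ^{sc i} w_i ≤ Cw·vol·(C θ^j Λ^{K−j})`. [folklore] -/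
theorem rateSlice_le_of_multiplicity {κ : Type*} {fac : Finset κ} {sc : κ → ℕ} {w : κ → ℝ} {Cw vol Λ C θ : ℝ}
    {K j : ℕ} (hM : T4RecentScale.Multiplicity fac sc w Cw vol Λ K) (hj : j ≤ K) (hC : 0 ≤ C) (hθ : 0 ≤ θ) :
    ∑ i ∈ fac with sc i = j, C * θ ^ sc i * w i ≤ Cw * vol * (C * θ ^ j * Λ ^ (K - j)) := by
  have e : ∑ i ∈ fac with sc i = j, C * θ ^ sc i * w i = C * θ ^ j * ∑ i ∈ fac with sc i = j, w i := by
    rw [Finset.mul_sum]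
    exact Finset.sum_congr rfl fun i hi => by rw [(Finset.mem_filter.mp hi).2]
  rw [e]
  calc C * θ ^ j * ∑ i ∈ fac with sc i = j, w i ≤ C * θ ^ j * (Cw * vol * Λ ^ (K - j)) :=
        mul_le_mul_of_nonneg_left (hM j hj) (mul_nonneg hC (pow_nonneg hθ j))
    _ = Cw * vol * (C * θ ^ j * Λ ^ (K - j)) := by ring

/-- `min` against a common factor: `S ≤ Cv·x`, `ρ ≤ Cv·y` ⇒ `min S ρ ≤ Cv·min x y`. [folklore] -/
theorem min_le_mul_min {S ρ Cv x y : ℝ} (hS : S ≤ Cv * x) (hρ : ρ ≤ Cv * y) : min S ρ ≤ Cv * min x y := by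
  rcases le_total x y with h | h
  · rw [min_eq_left h]; exact (min_le_left _ _).trans hS
  · rw [min_eq_right h]; exact (min_le_right _ _).trans hρ

/-- **PER-UNIT-VOLUME CROSSOVER BUDGET (minimum form).**  Per-slice SIZE radii `S_j ≤ Cv·SZ_j` and RATE radii
`ρ_j ≤ Cv·(C θ^j Λ^{K−j})` for `j ≤ K` give `Σ_{j ≤ K} min(S_j, ρ_j) ≤ Cv·Σ_{j+n=K} min(SZ_j, C θ^j Λ^n)` — `Cv ×` a branch
of `T4Crossover.crossoverDelta` (`SZ_j = E a^{K−j}`: the E-branch up to the factor `E`, `sum_min_le_eBranch`; `SZ_j = R₁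
gs K j^{κ₀}`: literally the R-branch). [folklore] -/
theorem sum_min_le_crossoverShape {S ρ SZ : ℕ → ℝ} {Cv C θ Λ : ℝ} {K : ℕ} (hS : ∀ j ≤ K, S j ≤ Cv * SZ j)
    (hρ : ∀ j ≤ K, ρ j ≤ Cv * (C * θ ^ j * Λ ^ (K - j))) :
    ∑ j ∈ range (K + 1), min (S j) (ρ j) ≤ Cv * ∑ p ∈ antidiagonal K, min (SZ p.1) (C * θ ^ p.1 * Λ ^ p.2) := by
  calc ∑ j ∈ range (K + 1), min (S j) (ρ j)
      ≤ ∑ j ∈ range (K + 1), Cv * min (SZ j) (C * θ ^ j * Λ ^ (K - j)) :=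
        Finset.sum_le_sum fun j hj =>
          min_le_mul_min (hS j (Nat.le_of_lt_succ (Finset.mem_range.mp hj)))
            (hρ j (Nat.le_of_lt_succ (Finset.mem_range.mp hj)))
    _ = Cv * ∑ j ∈ range (K + 1), min (SZ j) (C * θ ^ j * Λ ^ (K - j)) := by rw [Finset.mul_sum]
    _ = Cv * ∑ p ∈ antidiagonal K, min (SZ p.1) (C * θ ^ p.1 * Λ ^ p.2) :=
        congrArg (Cv * ·) (Finset.Nat.sum_antidiagonal_eq_sum_range_succ
          (fun j n => min (SZ j) (C * θ ^ j * Λ ^ n)) K).symm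

/-- The E-branch with its constant: if `SZ_j ≤ E·a^{K−j}` on the antidiagonal and `C ≤ E`, `0 ≤ E`, then
`Σ min(SZ_j, C θ^j Λ^n) ≤ E·Σ min(a^n, θ^j Λ^n)` — the first summand of `T4Crossover.crossoverDelta`. [folklore] -/
theorem sum_min_le_eBranch {SZ : ℕ → ℝ} {E a C θ Λ : ℝ} {K : ℕ} (hE : 0 ≤ E) (hθ : 0 ≤ θ) (hΛ : 0 ≤ Λ) (hCE : C ≤ E)
    (hSZ : ∀ p ∈ antidiagonal K, SZ p.1 ≤ E * a ^ p.2) :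
    ∑ p ∈ antidiagonal K, min (SZ p.1) (C * θ ^ p.1 * Λ ^ p.2)
      ≤ E * ∑ p ∈ antidiagonal K, min (a ^ p.2) (θ ^ p.1 * Λ ^ p.2) := by
  rw [Finset.mul_sum]
  refine Finset.sum_le_sum fun p hp => ?_
  rw [mul_min_of_nonneg _ _ hE]
  refine min_le_min (hSZ p hp) ?_
  have h0 : 0 ≤ θ ^ p.1 * Λ ^ p.2 := mul_nonneg (pow_nonneg hθ _) (pow_nonneg hΛ _)
  calc C * θ ^ p.1 * Λ ^ p.2 = C * (θ ^ p.1 * Λ ^ p.2) := by ring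
    _ ≤ E * (θ ^ p.1 * Λ ^ p.2) := mul_le_mul_of_nonneg_right hCE h0

/-- Three budget pieces against `Cv × crossoverDelta`: `RE ≤ Cv·(E·Σmin…)`, `RR ≤ Cv·(Σmin…)`, `RO ≤ Cv·w K` ⇒
`RE + RR + RO ≤ Cv · crossoverDelta E a θ Λ R₁ C κ₀ gs w K`. [folklore] -/
theorem le_mul_crossoverDelta {RE RR RO Cv E a θ Λ R₁ C : ℝ} {κ₀ : ℕ} {gs : ℕ → ℕ → ℝ} {w : ℕ → ℝ} {K : ℕ}
    (hE : RE ≤ Cv * (E * ∑ p ∈ antidiagonal K, min (a ^ p.2) (θ ^ p.1 * Λ ^ p.2)))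
    (hR : RR ≤ Cv * ∑ p ∈ antidiagonal K, min (R₁ * gs K p.1 ^ κ₀) (C * θ ^ p.1 * Λ ^ p.2))
    (hO : RO ≤ Cv * w K) :
    RE + RR + RO ≤ Cv * crossoverDelta E a θ Λ R₁ C κ₀ gs w K := by
  unfold crossoverDelta
  rw [mul_add, mul_add]
  exact add_le_add (add_le_add hE hR) hO

/-- `θ^j a^{K−j} ≤ max(θ,a)^K` for `0 ≤ θ, a`, `j ≤ K`. [folklore] -/
theorem pow_mul_pow_le_max_pow {θ a : ℝ} (hθ : 0 ≤ θ) (ha : 0 ≤ a) {j K : ℕ} (hj : j ≤ K) :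
    θ ^ j * a ^ (K - j) ≤ (max θ a) ^ K := by
  calc θ ^ j * a ^ (K - j) ≤ (max θ a) ^ j * (max θ a) ^ (K - j) :=
        mul_le_mul (pow_le_pow_left₀ hθ (le_max_left _ _) j) (pow_le_pow_left₀ ha (le_max_right _ _) _)
          (pow_nonneg ha _) (pow_nonneg (hθ.trans (le_max_left _ _)) _)
    _ = (max θ a) ^ K := by rw [← pow_add, Nat.add_sub_of_le hj]

/-- `Σ_{j ≤ K} θ^j a^{K−j} ≤ (K+1)·max(θ,a)^K`. [folklore] -/
theorem sum_pow_mul_pow_le {θ a : ℝ} (hθ : 0 ≤ θ) (ha : 0 ≤ a) (K : ℕ) :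
    ∑ j ∈ range (K + 1), θ ^ j * a ^ (K - j) ≤ ((K : ℝ) + 1) * (max θ a) ^ K := by
  calc ∑ j ∈ range (K + 1), θ ^ j * a ^ (K - j) ≤ ∑ j ∈ range (K + 1), (max θ a) ^ K :=
        Finset.sum_le_sum fun j hj => pow_mul_pow_le_max_pow hθ ha (Nat.le_of_lt_succ (Finset.mem_range.mp hj))
    _ = ((K : ℝ) + 1) * (max θ a) ^ K := by
        rw [Finset.sum_const, Finset.card_range, nsmul_eq_mul]; push_cast; ring

/-- HYPOTHESIS SHAPE — RATE × SIZE per slice (cell NEW ESTIMATE NE5′, NOT PRINTED; record §R2): the centred scale-`j`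
slice of a good term has remainder `m_j ≤ vol·E·θ^j·a^{K−j} + θ^j·Σ_{n ∈ [jlo, K]} [j ≤ n]·a^{n−j}·G_n`, `G_n ≥ 0` the
term's scale-`n` recent pending large-field volume in scale-`n` units (`|Γ_n ∩ Ω|` of (2.43) p. 263; `G_n ≤ vol·S·Λ^{K−n}`
by counting, or `≤ vol·v_K` after the Markov cap of §5).  Print has one run; the factor `θ^j` on the (2.43)-shaped size is
the η-rate of the DIFFERENCE of the two runs' renormalised slice functionals — an estimate about Bałaban's expansion, not
a theorem here. [folklore] (a definition; the estimate it names is NOT PRINTED) -/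
def SliceRateSize (m : ℕ → ℝ) (vol E θ a : ℝ) (G : ℕ → ℝ) (jlo K : ℕ) : Prop :=
  ∀ j ≤ K, m j ≤ vol * E * (θ ^ j * a ^ (K - j))
    + θ ^ j * ∑ n ∈ Icc jlo K, (if j ≤ n then a ^ (n - j) else 0) * G n

/-- **PER-UNIT-VOLUME BUDGET, PRODUCT FORM.**  Under `SliceRateSize`, with `θ, a ∈ [0,1]`, `0 ≤ vol·E` and `G ≥ 0` on the
window: `Σ_{j ≤ K} m_j ≤ (K+1)·(vol·E·ρ^K + Σ_{n ∈ [jlo,K]} ρ^n G_n)`, `ρ = max(θ, a)`. [folklore] -/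
theorem sum_slice_le_of_rateSize {m G : ℕ → ℝ} {vol E θ a : ℝ} {jlo K : ℕ} (h : SliceRateSize m vol E θ a G jlo K)
    (hθ : 0 ≤ θ) (ha : 0 ≤ a) (hE : 0 ≤ vol * E) (hG : ∀ n ∈ Icc jlo K, 0 ≤ G n) :
    ∑ j ∈ range (K + 1), m j
      ≤ ((K : ℝ) + 1) * (vol * E * (max θ a) ^ K + ∑ n ∈ Icc jlo K, (max θ a) ^ n * G n) := by
  have hρ0 : 0 ≤ max θ a := hθ.trans (le_max_left _ _)
  have h1 : ∀ j ∈ range (K + 1), m j ≤ vol * E * (θ ^ j * a ^ (K - j))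
      + θ ^ j * ∑ n ∈ Icc jlo K, (if j ≤ n then a ^ (n - j) else 0) * G n :=
    fun j hj => h j (Nat.le_of_lt_succ (Finset.mem_range.mp hj))
  refine (Finset.sum_le_sum h1).trans ?_
  rw [Finset.sum_add_distrib]
  have hA : ∑ j ∈ range (K + 1), vol * E * (θ ^ j * a ^ (K - j)) ≤ ((K : ℝ) + 1) * (vol * E * (max θ a) ^ K) := by
    rw [← Finset.mul_sum]
    calc vol * E * ∑ j ∈ range (K + 1), θ ^ j * a ^ (K - j) ≤ vol * E * (((K : ℝ) + 1) * (max θ a) ^ K) :=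
          mul_le_mul_of_nonneg_left (sum_pow_mul_pow_le hθ ha K) hE
      _ = ((K : ℝ) + 1) * (vol * E * (max θ a) ^ K) := by ring
  have hB : ∑ j ∈ range (K + 1), θ ^ j * ∑ n ∈ Icc jlo K, (if j ≤ n then a ^ (n - j) else 0) * G n
      ≤ ((K : ℝ) + 1) * ∑ n ∈ Icc jlo K, (max θ a) ^ n * G n := by
    have hterm : ∀ j ∈ range (K + 1), ∀ n ∈ Icc jlo K,
        θ ^ j * ((if j ≤ n then a ^ (n - j) else 0) * G n) ≤ (max θ a) ^ n * G n := by
      intro j _ n hn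
      rw [← mul_assoc]
      refine mul_le_mul_of_nonneg_right ?_ (hG n hn)
      split_ifs with hjn
      · exact pow_mul_pow_le_max_pow hθ ha hjn
      · rw [mul_zero]; exact pow_nonneg hρ0 n
    calc ∑ j ∈ range (K + 1), θ ^ j * ∑ n ∈ Icc jlo K, (if j ≤ n then a ^ (n - j) else 0) * G n
        = ∑ j ∈ range (K + 1), ∑ n ∈ Icc jlo K, θ ^ j * ((if j ≤ n then a ^ (n - j) else 0) * G n) :=
          Finset.sum_congr rfl fun j _ => by rw [Finset.mul_sum]
      _ ≤ ∑ j ∈ range (K + 1), ∑ n ∈ Icc jlo K, (max θ a) ^ n * G n :=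
          Finset.sum_le_sum fun j hj => Finset.sum_le_sum fun n hn => hterm j hj n hn
      _ = ((K : ℝ) + 1) * ∑ n ∈ Icc jlo K, (max θ a) ^ n * G n := by
          rw [Finset.sum_const, Finset.card_range, nsmul_eq_mul]; push_cast; ring
  calc _ ≤ ((K : ℝ) + 1) * (vol * E * (max θ a) ^ K) + ((K : ℝ) + 1) * ∑ n ∈ Icc jlo K, (max θ a) ^ n * G n :=
        add_le_add hA hB
    _ = ((K : ℝ) + 1) * (vol * E * (max θ a) ^ K + ∑ n ∈ Icc jlo K, (max θ a) ^ n * G n) := by ring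

/-! ## §3 The COMMON-CONSTANT budget and other rate-shaped recent contributions: WINDOW SUMS

Cell hazard H-U5b-1 (T4-DAG v4 §5 T4-U5.E-b, `t4/T4-EST-U5b.md` (e)(ii); NOT PRINTED): the term constant `C_τ` deviates
from the class constant `c_K` only through degrees of freedom created in the RECENT window `j⋆(K) ≤ j ≤ K` (interface
condition I-3 of `t4/T4-EST-U5c.md`: older PENDING structures put the term in the bad class), each deviation of rate shape
`Cs·(θ^j + δ_j)·w_i`; H-U5b-1′: `c_K` is t-independent (structural: the field-independent constants do not see the
unit-scale insertion).  Then `|C_τ − c_K| ≤ Cs(1 + C_δ)·Cw·vol·Σ_{j=j⋆}^{K} θ^j Λ^{K−j}`, and the window sum is summable in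
`K` when `K − j⋆(K) ≤ σK + 1` and `θ(Λ/θ)^σ < 1` (`σ` from `T4Crossover.exists_recentRate_lt_one`).  The SAME window sum
budgets every rate-only kind of node U5b at recent scales (pending, insert, boundary: §4). [folklore arithmetic] -/

/-- The WINDOW SUM `Σ_{j=j⋆}^{K} θ^j Λ^{K−j}`. [folklore] -/
noncomputable def windowSum (θ Λ : ℝ) (jstar K : ℕ) : ℝ := ∑ j ∈ Icc jstar K, θ ^ j * Λ ^ (K - j)

/-- The window sum is nonnegative for `θ, Λ ≥ 0`. [folklore] -/
theorem windowSum_nonneg {θ Λ : ℝ} (hθ : 0 ≤ θ) (hΛ : 0 ≤ Λ) (jstar K : ℕ) : 0 ≤ windowSum θ Λ jstar K :=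
  Finset.sum_nonneg fun _ _ => mul_nonneg (pow_nonneg hθ _) (pow_nonneg hΛ _)

/-- RECENT-ONLY degrees of freedom: every creation scale lies in the window `[j⋆, K]`. [folklore] -/
def RecentOnly {κ : Type*} (dof : Finset κ) (sc : κ → ℕ) (jstar K : ℕ) : Prop :=
  ∀ i ∈ dof, jstar ≤ sc i ∧ sc i ≤ K

/-- MULTIPLICITY ON THE WINDOW (the (0.26) chain of `T4RecentScale.Multiplicity`, asked only for `j⋆ ≤ j ≤ K`):
`Σ_{sc i = j} w_i ≤ Cw·vol·Λ^{K−j}`. [folklore] -/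
def WindowMultiplicity {κ : Type*} (dof : Finset κ) (sc : κ → ℕ) (w : κ → ℝ) (Cw vol Λ : ℝ) (jstar K : ℕ) : Prop :=
  ∀ j, jstar ≤ j → j ≤ K → ∑ i ∈ dof with sc i = j, w i ≤ Cw * vol * Λ ^ (K - j)

/-- Full multiplicity restricts to the window. [folklore] -/
theorem windowMultiplicity_of_multiplicity {κ : Type*} {dof : Finset κ} {sc : κ → ℕ} {w : κ → ℝ} {Cw vol Λ : ℝ}
    {jstar K : ℕ} (h : T4RecentScale.Multiplicity dof sc w Cw vol Λ K) :
    WindowMultiplicity dof sc w Cw vol Λ jstar K := fun j _ hj => h j hj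

/-- **RATE PROFILE ON THE WINDOW ⇒ `vol ×` WINDOW SUM**: `Σ_i C θ^{sc i} w_i ≤ C·(Cw·vol)·windowSum θ Λ j⋆ K` for
recent-only degrees of freedom with window multiplicity. [folklore] -/
theorem sum_rate_le_windowSum {κ : Type*} {dof : Finset κ} {sc : κ → ℕ} {w : κ → ℝ} {Cw vol Λ C θ : ℝ}
    {jstar K : ℕ} (hC : 0 ≤ C) (hθ : 0 ≤ θ) (hrec : RecentOnly dof sc jstar K)
    (hM : WindowMultiplicity dof sc w Cw vol Λ jstar K) :
    ∑ i ∈ dof, C * θ ^ sc i * w i ≤ C * (Cw * vol) * windowSum θ Λ jstar K := by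
  have hsc : ∀ i ∈ dof, sc i ∈ Icc jstar K := fun i hi => Finset.mem_Icc.mpr (hrec i hi)
  calc ∑ i ∈ dof, C * θ ^ sc i * w i ≤ ∑ j ∈ Icc jstar K, C * θ ^ j * (Cw * vol * Λ ^ (K - j)) :=
        T4RecentScale.sum_profile_le_of_slices (ρ := fun j => C * θ ^ j) (M := fun j => Cw * vol * Λ ^ (K - j))
          hsc (fun j _ => mul_nonneg hC (pow_nonneg hθ j))
          (fun j hj => hM j (Finset.mem_Icc.mp hj).1 (Finset.mem_Icc.mp hj).2)
    _ = C * (Cw * vol) * windowSum θ Λ jstar K := by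
        rw [windowSum, Finset.mul_sum]; exact Finset.sum_congr rfl fun j _ => by ring

/-- HYPOTHESIS SHAPE — RECENT DEVIATION OF THE TERM CONSTANT (cell hazard H-U5b-1, NOT PRINTED; print, one run: the
constants are term-dependent, p. 262 of [Balaban1988Convergent] «The constant E_k (depending on {Ω_j}, {Λ_j} also) …»,
and the normalization constants of large-field operations are `O(log g_j^{−2})` per operation, [Balaban1989LargeFieldII]
p. 380).  The term constant is `C_τ = c_K + Σ_{i ∈ dof} e_i` over the term's RECENT degrees of freedom `dof` (interface
condition I-3 of `t4/T4-EST-U5c.md`), with `|e_i| ≤ Cs·(θ^{sc i} + δ(sc i))·w_i`, nonnegative weights and window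
multiplicity.  See record §R1 for the objection that RENORMALISED old structures also carry term-dependent constants.
[folklore] (a definition; the hypothesis it names, H-U5b-1, is NOT PRINTED) -/
structure RecentDeviation {κ : Type*} (dof : Finset κ) (sc : κ → ℕ) (w e : κ → ℝ) (Cs θ : ℝ) (δ : ℕ → ℝ)
    (Cw vol Λ : ℝ) (jstar K : ℕ) : Prop where
  nonneg : ∀ i ∈ dof, 0 ≤ w i
  dev_le : ∀ i ∈ dof, |e i| ≤ Cs * (θ ^ sc i + δ (sc i)) * w i
  recent : RecentOnly dof sc jstar K
  mult : WindowMultiplicity dof sc w Cw vol Λ jstar K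

/-- **THE COMMON-CONSTANT BUDGET `s_τ ≤ vol·s_K`**: under `RecentDeviation` with node U2's merged discrepancy
(`T4CauchySum.InjectedRate Cδ 0 θ δ`), `|Σ_{dof} e_i| ≤ Cs(1 + Cδ)·(Cw·vol)·windowSum θ Λ j⋆ K`. [folklore] -/
theorem abs_sum_dev_le_windowSum {κ : Type*} {dof : Finset κ} {sc : κ → ℕ} {w e : κ → ℝ} {Cs θ Cδ : ℝ}
    {δ : ℕ → ℕ → ℝ} {Cw vol Λ : ℝ} {jstar K : ℕ} (h : RecentDeviation dof sc w e Cs θ (δ K) Cw vol Λ jstar K)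
    (hδ : T4CauchySum.InjectedRate Cδ 0 θ δ) (hCs : 0 ≤ Cs) (hCδ : 0 ≤ Cδ) (hθ : 0 ≤ θ) :
    |∑ i ∈ dof, e i| ≤ Cs * (1 + Cδ) * (Cw * vol) * windowSum θ Λ jstar K := by
  have hdev : ∀ i ∈ dof, |e i| ≤ Cs * (1 + Cδ) * θ ^ sc i * w i := fun i hi => by
    have h1 := T4RecentScale.theta_add_delta_le hδ (h.recent i hi).2
    calc |e i| ≤ Cs * (θ ^ sc i + δ K (sc i)) * w i := h.dev_le i hi
      _ ≤ Cs * ((1 + Cδ) * θ ^ sc i) * w i :=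
          mul_le_mul_of_nonneg_right (mul_le_mul_of_nonneg_left h1 hCs) (h.nonneg i hi)
      _ = Cs * (1 + Cδ) * θ ^ sc i * w i := by ring
  calc |∑ i ∈ dof, e i| ≤ ∑ i ∈ dof, |e i| := Finset.abs_sum_le_sum_abs _ _
    _ ≤ ∑ i ∈ dof, Cs * (1 + Cδ) * θ ^ sc i * w i := Finset.sum_le_sum hdev
    _ ≤ Cs * (1 + Cδ) * (Cw * vol) * windowSum θ Λ jstar K :=
        sum_rate_le_windowSum (mul_nonneg hCs (by linarith)) hθ h.recent h.mult

/-- The deviation of the term constant from the class constant: `C_τ = c_K + Σ e_i` ⇒ `|C_τ − c_K| ≤ vol·s_K`-shape.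
[folklore] -/
theorem abs_sub_centre_le_windowSum {κ : Type*} {dof : Finset κ} {sc : κ → ℕ} {w e : κ → ℝ} {Cs θ Cδ : ℝ}
    {δ : ℕ → ℕ → ℝ} {Cw vol Λ Cτ c₀ : ℝ} {jstar K : ℕ} (hC : Cτ = c₀ + ∑ i ∈ dof, e i)
    (h : RecentDeviation dof sc w e Cs θ (δ K) Cw vol Λ jstar K) (hδ : T4CauchySum.InjectedRate Cδ 0 θ δ)
    (hCs : 0 ≤ Cs) (hCδ : 0 ≤ Cδ) (hθ : 0 ≤ θ) :
    |Cτ - c₀| ≤ Cs * (1 + Cδ) * (Cw * vol) * windowSum θ Λ jstar K := by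
  rw [hC, add_sub_cancel_left]; exact abs_sum_dev_le_windowSum h hδ hCs hCδ hθ

/-- ONE WINDOW TERM: for `0 < θ ≤ Λ`, `j ≤ K` and `K − j ≤ σK + 1`, `θ^j Λ^{K−j} ≤ (Λ/θ)·(θ(Λ/θ)^σ)^K` (write
`θ^j Λ^{K−j} = θ^K (Λ/θ)^{K−j}` and use `Λ/θ ≥ 1`). [folklore] -/
theorem pow_mul_pow_le_window {θ Λ σ : ℝ} (hθ : 0 < θ) (hθΛ : θ ≤ Λ) {j K : ℕ} (hjK : j ≤ K)
    (hwin : ((K - j : ℕ) : ℝ) ≤ σ * K + 1) :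
    θ ^ j * Λ ^ (K - j) ≤ (Λ / θ) * (θ * (Λ / θ) ^ σ) ^ K := by
  obtain ⟨n, rfl⟩ : ∃ n, K = j + n := ⟨K - j, (Nat.add_sub_of_le hjK).symm⟩
  rw [Nat.add_sub_cancel_left] at hwin ⊢
  have hr1 : 1 ≤ Λ / θ := (one_le_div hθ).mpr hθΛ
  have hr0 : 0 < Λ / θ := lt_of_lt_of_le one_pos hr1
  have hΛ : θ * (Λ / θ) = Λ := by field_simp
  have h1 : θ ^ j * Λ ^ n = θ ^ (j + n) * (Λ / θ) ^ n := by
    rw [pow_add, mul_assoc, ← mul_pow, hΛ]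
  have h2 : (Λ / θ) ^ n ≤ (Λ / θ) * ((Λ / θ) ^ σ) ^ (j + n) := by
    have e1 : (Λ / θ) ^ n = (Λ / θ) ^ ((n : ℕ) : ℝ) := (Real.rpow_natCast _ _).symm
    have e2 : (Λ / θ) * ((Λ / θ) ^ σ) ^ (j + n) = (Λ / θ) ^ (σ * ((j + n : ℕ) : ℝ) + 1) := by
      rw [Real.rpow_add hr0, Real.rpow_one, Real.rpow_mul hr0.le, Real.rpow_natCast,
        mul_comm (Λ / θ) (((Λ / θ) ^ σ) ^ (j + n))]
    rw [e1, e2]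
    exact Real.rpow_le_rpow_of_exponent_le hr1 hwin
  calc θ ^ j * Λ ^ n = θ ^ (j + n) * (Λ / θ) ^ n := h1
    _ ≤ θ ^ (j + n) * ((Λ / θ) * ((Λ / θ) ^ σ) ^ (j + n)) :=
        mul_le_mul_of_nonneg_left h2 (pow_nonneg hθ.le _)
    _ = (Λ / θ) * (θ * (Λ / θ) ^ σ) ^ (j + n) := by rw [mul_pow]; ring

/-- **THE WINDOW SUM IS SMALL**: `windowSum θ Λ j⋆ K ≤ (K+1)·(Λ/θ)·(θ(Λ/θ)^σ)^K` when `K − j⋆ ≤ σK + 1`. [folklore] -/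
theorem windowSum_le {θ Λ σ : ℝ} (hθ : 0 < θ) (hθΛ : θ ≤ Λ) {jstar K : ℕ}
    (hwin : ((K - jstar : ℕ) : ℝ) ≤ σ * K + 1) :
    windowSum θ Λ jstar K ≤ ((K : ℝ) + 1) * ((Λ / θ) * (θ * (Λ / θ) ^ σ) ^ K) := by
  have hΛ0 : 0 < Λ := lt_of_lt_of_le hθ hθΛ
  have hq0 : 0 ≤ (Λ / θ) * (θ * (Λ / θ) ^ σ) ^ K := by positivity
  unfold windowSum
  calc ∑ j ∈ Icc jstar K, θ ^ j * Λ ^ (K - j) ≤ ∑ j ∈ Icc jstar K, (Λ / θ) * (θ * (Λ / θ) ^ σ) ^ K := by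
        refine Finset.sum_le_sum fun j hj => ?_
        have hj' := Finset.mem_Icc.mp hj
        refine pow_mul_pow_le_window hθ hθΛ hj'.2 (le_trans ?_ hwin)
        exact_mod_cast Nat.sub_le_sub_left hj'.1 K
    _ = ((Icc jstar K).card : ℝ) * ((Λ / θ) * (θ * (Λ / θ) ^ σ) ^ K) := by
        rw [Finset.sum_const, nsmul_eq_mul]
    _ ≤ ((K : ℝ) + 1) * ((Λ / θ) * (θ * (Λ / θ) ^ σ) ^ K) := by
        refine mul_le_mul_of_nonneg_right ?_ hq0
        have : (Icc jstar K).card ≤ K + 1 := by rw [Nat.card_Icc]; omega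
        exact_mod_cast this

/-- **SUMMABILITY OF THE WINDOW SUMS** along any cut with `K − j⋆(K) ≤ σK + 1` and `θ(Λ/θ)^σ < 1` (comparison with
`(K+1)·q^K`, `T4CauchySum.summable_succ_pow_mul_geometric`). [folklore] -/
theorem summable_windowSum {θ Λ σ : ℝ} (hθ : 0 < θ) (hθΛ : θ ≤ Λ) (hq : θ * (Λ / θ) ^ σ < 1) {jstar : ℕ → ℕ}
    (hwin : ∀ K : ℕ, ((K - jstar K : ℕ) : ℝ) ≤ σ * K + 1) :
    Summable (fun K => windowSum θ Λ (jstar K) K) := by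
  have hΛ0 : 0 < Λ := lt_of_lt_of_le hθ hθΛ
  have hq0 : 0 ≤ θ * (Λ / θ) ^ σ := by positivity
  have hmaj : Summable (fun K : ℕ => (Λ / θ) * (((K : ℝ) + 1) ^ 1 * (θ * (Λ / θ) ^ σ) ^ K)) :=
    (T4CauchySum.summable_succ_pow_mul_geometric hq0 hq 1).mul_left (Λ / θ)
  refine Summable.of_nonneg_of_le (fun K => windowSum_nonneg hθ.le hΛ0.le _ _) (fun K => ?_) hmaj
  calc windowSum θ Λ (jstar K) K ≤ ((K : ℝ) + 1) * ((Λ / θ) * (θ * (Λ / θ) ^ σ) ^ K) :=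
        windowSum_le hθ hθΛ (hwin K)
    _ = (Λ / θ) * (((K : ℝ) + 1) ^ 1 * (θ * (Λ / θ) ^ σ) ^ K) := by ring

/-- The window for the PRODUCT form of §2 carries the extra factor `(K+1)`: still summable. [folklore] -/
theorem summable_succ_mul_windowSum {θ Λ σ : ℝ} (hθ : 0 < θ) (hθΛ : θ ≤ Λ) (hq : θ * (Λ / θ) ^ σ < 1)
    {jstar : ℕ → ℕ} (hwin : ∀ K : ℕ, ((K - jstar K : ℕ) : ℝ) ≤ σ * K + 1) :
    Summable (fun K : ℕ => ((K : ℝ) + 1) * windowSum θ Λ (jstar K) K) := by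
  have hΛ0 : 0 < Λ := lt_of_lt_of_le hθ hθΛ
  have hq0 : 0 ≤ θ * (Λ / θ) ^ σ := by positivity
  have hmaj : Summable (fun K : ℕ => (Λ / θ) * (((K : ℝ) + 1) ^ 2 * (θ * (Λ / θ) ^ σ) ^ K)) :=
    (T4CauchySum.summable_succ_pow_mul_geometric hq0 hq 2).mul_left (Λ / θ)
  refine Summable.of_nonneg_of_le
    (fun K => mul_nonneg (by positivity) (windowSum_nonneg hθ.le hΛ0.le _ _)) (fun K => ?_) hmaj
  calc ((K : ℝ) + 1) * windowSum θ Λ (jstar K) K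
      ≤ ((K : ℝ) + 1) * (((K : ℝ) + 1) * ((Λ / θ) * (θ * (Λ / θ) ^ σ) ^ K)) :=
        mul_le_mul_of_nonneg_left (windowSum_le hθ hθΛ (hwin K)) (by positivity)
    _ = (Λ / θ) * (((K : ℝ) + 1) ^ 2 * (θ * (Λ / θ) ^ σ) ^ K) := by ring

/-- A cut rate `σ ∈ (0, 1]` with `θ(Λ/θ)^σ < 1` exists for `0 < θ < 1`, `θ ≤ Λ` (`T4Crossover.exists_recentRate_lt_one`,
clipped at `1`). [folklore] -/
theorem exists_cut {θ Λ : ℝ} (hθ : 0 < θ) (hθ1 : θ < 1) (hθΛ : θ ≤ Λ) :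
    ∃ σ : ℝ, 0 < σ ∧ σ ≤ 1 ∧ θ * (Λ / θ) ^ σ < 1 := by
  obtain ⟨c, hc0, hc⟩ := T4Crossover.exists_recentRate_lt_one hθ hθ1 hθΛ
  have hr1 : 1 ≤ Λ / θ := (one_le_div hθ).mpr hθΛ
  refine ⟨min c 1, lt_min hc0 one_pos, min_le_right _ _, lt_of_le_of_lt ?_ hc⟩
  exact mul_le_mul_of_nonneg_left (Real.rpow_le_rpow_of_exponent_le hr1 (min_le_left _ _)) hθ.le

/-- **ONE CUT SERVES BOTH**: `j⋆(K) = K − ⌈σK⌉` (T4-DAG v4 §2 U5c "j⋆(K) = K − ⌈cK⌉"). [folklore] -/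
noncomputable def jstarOf (σ : ℝ) (K : ℕ) : ℕ := K - ⌈σ * K⌉₊

/-- `⌈σK⌉ ≤ K` for `σ ≤ 1`. [folklore] -/
theorem ceil_le_self {σ : ℝ} (hσ1 : σ ≤ 1) (K : ℕ) : ⌈σ * K⌉₊ ≤ K := by
  refine Nat.ceil_le.mpr ?_
  calc σ * K ≤ 1 * K := mul_le_mul_of_nonneg_right hσ1 (Nat.cast_nonneg K)
    _ = K := one_mul _

/-- The window length of the cut is `⌈σK⌉`. [folklore] -/
theorem sub_jstarOf {σ : ℝ} (hσ1 : σ ≤ 1) (K : ℕ) : K - jstarOf σ K = ⌈σ * K⌉₊ := by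
  have h := ceil_le_self hσ1 K
  unfold jstarOf; omega

/-- The cut gives the `hfrac` input of `T4WeightBudget.summable_weightMajorant` / `T4HistoryPeeling.relWeightBound_of_slotDom_twoRate`
with `c = σ` (interface I-1 of `t4/T4-EST-U5c.md`): `σK ≤ K − j⋆(K)`. [folklore] -/
theorem jstarOf_frac {σ : ℝ} (hσ1 : σ ≤ 1) (K : ℕ) : σ * K ≤ ((K - jstarOf σ K : ℕ) : ℝ) := by
  rw [sub_jstarOf hσ1]; exact Nat.le_ceil _

/-- … and the window input of `summable_windowSum`. [folklore] -/
theorem jstarOf_window {σ : ℝ} (hσ0 : 0 ≤ σ) (hσ1 : σ ≤ 1) (K : ℕ) :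
    ((K - jstarOf σ K : ℕ) : ℝ) ≤ σ * K + 1 := by
  rw [sub_jstarOf hσ1]; exact (Nat.ceil_lt_add_one (mul_nonneg hσ0 (Nat.cast_nonneg K))).le

/-- **THE CUT, PACKAGED**: for `0 < θ < 1 ≤ …`, `θ ≤ Λ` there is `σ ∈ (0,1]` such that along `j⋆ = jstarOf σ` the window
sums are summable AND `σK ≤ K − j⋆(K)` (interface condition I-1 of `t4/T4-EST-U5c.md`). [folklore] -/
theorem exists_cut_summable {θ Λ : ℝ} (hθ : 0 < θ) (hθ1 : θ < 1) (hθΛ : θ ≤ Λ) :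
    ∃ σ : ℝ, 0 < σ ∧ σ ≤ 1 ∧ (∀ K : ℕ, σ * K ≤ ((K - jstarOf σ K : ℕ) : ℝ)) ∧
      Summable (fun K => windowSum θ Λ (jstarOf σ K) K) := by
  obtain ⟨σ, hσ0, hσ1, hq⟩ := exists_cut hθ hθ1 hθΛ
  exact ⟨σ, hσ0, hσ1, jstarOf_frac hσ1, summable_windowSum hθ hθΛ hq (jstarOf_window hσ0.le hσ1)⟩

/-- Along the same cut the weight majorant of `T4WeightBudget` (NE7b (Q)) is summable. [folklore] -/
theorem summable_weightMajorant_of_cut {r V σ : ℝ} (h0 : 0 < r) (h1 : r < 1) (hV : 0 ≤ V) (hσ0 : 0 < σ)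
    (hσ1 : σ ≤ 1) : Summable (fun K => V * r ^ (K - jstarOf σ K)) :=
  T4WeightBudget.summable_weightMajorant h0 h1 hV hσ0 (jstarOf_frac hσ1)

/-! ## §3b The LOGARITHMIC window (record §R3): ONE LOG CUT serves both budgets, for EVERY `θ < 1`

With the linear cut `j⋆(K) = K − ⌈σK⌉` the window holds `Λ^{⌈σK⌉}` recent cubes per unit volume (trivial count), so only
quantities with a GEOMETRIC rate `θ^j` survive the window sum, and only when `θ(Λ/θ)^σ < 1`.  The bad-class budget of
`t4/T4-EST-U5c.md` needs much less than a linear window: `Σ_K V·r^{K − j⋆(K)} < ∞` already holds when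
`K − j⋆(K) ≥ min(K, C·log(K+1))` with `C·(−log r) > 1` (a p-series plus a geometric series, `summable_weightMajorant_log`).
With the LOG CUT `jlog(K) = K − ⌈C·log(K+1)⌉` the window's trivial count is POLYNOMIAL in `K` (`windowCount_log_le`),
hence the θ-window sum is `poly(K)·θ^K` — summable for every `θ < 1` with NO condition linking `θ` and `Λ`
(`summable_windowSum_log`) — and a per-cube discrepancy that is only POLYNOMIALLY small in `K`, `d_K ≤ D·(K+1)^{−q}`
(record §R3: the R-type response of old slices near recent large fields, smallness `Σ_j θ^j g_j^{κ₀} ≍ K^{−κ₀/2}` because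
`g_j^{−2} ≍ g_K^{−2} + b·(K − j)`), is budgeted by TRIVIAL counting as soon as `q ≥ ⌈C·log Λ⌉ + 3`
(`summable_polyRate_logWindow`).  Nothing here is an estimate about Bałaban's expansions. [folklore arithmetic] -/

/-- ONE LOGARITHMIC CUT: `jlog(K) = K − ⌈C·log(K+1)⌉` (truncated subtraction). [folklore] -/
noncomputable def jlogOf (C : ℝ) (K : ℕ) : ℕ := K - ⌈C * Real.log ((K : ℝ) + 1)⌉₊

/-- `jlog(K) ≤ K`. [folklore] -/
theorem jlogOf_le (C : ℝ) (K : ℕ) : jlogOf C K ≤ K := Nat.sub_le _ _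

/-- The log window is at most `C·log(K+1) + 1` long … [folklore] -/
theorem sub_jlogOf_le {C : ℝ} (hC : 0 ≤ C) (K : ℕ) :
    ((K - jlogOf C K : ℕ) : ℝ) ≤ C * Real.log ((K : ℝ) + 1) + 1 := by
  have hK : (1 : ℝ) ≤ (K : ℝ) + 1 := by have := (Nat.cast_nonneg K : (0 : ℝ) ≤ K); linarith
  have hx : 0 ≤ C * Real.log ((K : ℝ) + 1) := mul_nonneg hC (Real.log_nonneg hK)
  have h1 : K - jlogOf C K ≤ ⌈C * Real.log ((K : ℝ) + 1)⌉₊ := by unfold jlogOf; omega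
  calc ((K - jlogOf C K : ℕ) : ℝ) ≤ (⌈C * Real.log ((K : ℝ) + 1)⌉₊ : ℝ) := by exact_mod_cast h1
    _ ≤ C * Real.log ((K : ℝ) + 1) + 1 := (Nat.ceil_lt_add_one hx).le

/-- … and at least `min(K, C·log(K+1))` long. [folklore] -/
theorem min_le_sub_jlogOf (C : ℝ) (K : ℕ) :
    min (K : ℝ) (C * Real.log ((K : ℝ) + 1)) ≤ ((K - jlogOf C K : ℕ) : ℝ) := by
  unfold jlogOf
  by_cases h : ⌈C * Real.log ((K : ℝ) + 1)⌉₊ ≤ K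
  · have e : K - (K - ⌈C * Real.log ((K : ℝ) + 1)⌉₊) = ⌈C * Real.log ((K : ℝ) + 1)⌉₊ := by omega
    rw [e]; exact le_trans (min_le_right _ _) (Nat.le_ceil _)
  · have e : K - (K - ⌈C * Real.log ((K : ℝ) + 1)⌉₊) = K := by omega
    rw [e]; exact min_le_left _ _

/-- `Λ^{C·log(K+1)} = (K+1)^{C·log Λ}`. [folklore] -/
theorem rpow_log_swap {Λ : ℝ} (hΛ : 0 < Λ) (C : ℝ) (K : ℕ) :
    Λ ^ (C * Real.log ((K : ℝ) + 1)) = ((K : ℝ) + 1) ^ (C * Real.log Λ) := by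
  have hK : (0 : ℝ) < (K : ℝ) + 1 := by positivity
  rw [Real.rpow_def_of_pos hΛ, Real.rpow_def_of_pos hK]
  congr 1; ring

/-- The log window's LARGEST VOLUME FACTOR is polynomial: `Λ^{K − jlog(K)} ≤ Λ·(K+1)^{C log Λ}` for `Λ ≥ 1`. [folklore] -/
theorem pow_logWindow_le {Λ C : ℝ} (hΛ : 1 ≤ Λ) (hC : 0 ≤ C) (K : ℕ) :
    Λ ^ (K - jlogOf C K) ≤ Λ * ((K : ℝ) + 1) ^ (C * Real.log Λ) := by
  have hΛ0 : 0 < Λ := lt_of_lt_of_le one_pos hΛ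
  calc Λ ^ (K - jlogOf C K) = Λ ^ (((K - jlogOf C K : ℕ) : ℝ)) := (Real.rpow_natCast Λ _).symm
    _ ≤ Λ ^ (C * Real.log ((K : ℝ) + 1) + 1) := Real.rpow_le_rpow_of_exponent_le hΛ (sub_jlogOf_le hC K)
    _ = Λ * ((K : ℝ) + 1) ^ (C * Real.log Λ) := by
        rw [Real.rpow_add hΛ0, Real.rpow_one, rpow_log_swap hΛ0, mul_comm]

/-- … and its SMALLEST RATE is `θ^K` up to a polynomial: `θ^{jlog(K)} ≤ θ^K·θ⁻¹·(K+1)^{C log θ⁻¹}` (`0 < θ ≤ 1`).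
[folklore] -/
theorem pow_logCut_le {θ C : ℝ} (hθ : 0 < θ) (hθ1 : θ ≤ 1) (hC : 0 ≤ C) (K : ℕ) :
    θ ^ jlogOf C K ≤ θ ^ K * (θ⁻¹ * ((K : ℝ) + 1) ^ (C * Real.log θ⁻¹)) := by
  have e : θ ^ jlogOf C K = θ ^ K * θ⁻¹ ^ (K - jlogOf C K) := by
    rw [inv_pow, ← div_eq_mul_inv, eq_div_iff (pow_ne_zero _ hθ.ne'), ← pow_add,
      Nat.add_sub_of_le (jlogOf_le C K)]
  rw [e]
  exact mul_le_mul_of_nonneg_left (pow_logWindow_le ((one_le_inv₀ hθ).2 hθ1) hC K) (pow_nonneg hθ.le _)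

/-- Crude bound of a window sum by its length times its largest term (`0 ≤ θ ≤ 1 ≤ Λ`). [folklore] -/
theorem windowSum_le_length {θ Λ : ℝ} (hθ0 : 0 ≤ θ) (hθ1 : θ ≤ 1) (hΛ : 1 ≤ Λ) {j K : ℕ} (hj : j ≤ K) :
    windowSum θ Λ j K ≤ (((K - j : ℕ) : ℝ) + 1) * (θ ^ j * Λ ^ (K - j)) := by
  unfold windowSum
  calc ∑ i ∈ Icc j K, θ ^ i * Λ ^ (K - i) ≤ ∑ i ∈ Icc j K, θ ^ j * Λ ^ (K - j) := by
        refine Finset.sum_le_sum fun i hi => ?_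
        have hi' := Finset.mem_Icc.mp hi
        exact mul_le_mul (pow_le_pow_of_le_one hθ0 hθ1 hi'.1) (pow_le_pow_right₀ hΛ (by omega))
          (pow_nonneg (le_trans zero_le_one hΛ) _) (pow_nonneg hθ0 _)
    _ = (((K - j : ℕ) : ℝ) + 1) * (θ ^ j * Λ ^ (K - j)) := by
        rw [Finset.sum_const, nsmul_eq_mul, Nat.card_Icc]
        have : K + 1 - j = (K - j) + 1 := by omega
        rw [this]; push_cast; ring

/-- TRIVIAL COUNTING ON THE LOG WINDOW IS POLYNOMIAL: `Σ_{j=jlog(K)}^{K} Λ^{K−j} ≤ (C+2)·Λ·(K+1)^{⌈C log Λ⌉ + 1}`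
(the count is `windowSum 1 Λ`). [folklore] -/
theorem windowCount_log_le {Λ C : ℝ} (hΛ : 1 ≤ Λ) (hC : 0 ≤ C) (K : ℕ) :
    windowSum 1 Λ (jlogOf C K) K ≤ (C + 2) * Λ * ((K : ℝ) + 1) ^ (⌈C * Real.log Λ⌉₊ + 1) := by
  have hΛ0 : 0 < Λ := lt_of_lt_of_le one_pos hΛ
  have hK0 : (0 : ℝ) ≤ (K : ℝ) := Nat.cast_nonneg K
  have hK1 : (1 : ℝ) ≤ (K : ℝ) + 1 := by linarith
  have hlen : (((K - jlogOf C K : ℕ) : ℝ) + 1) ≤ (C + 2) * ((K : ℝ) + 1) := by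
    have h1 := sub_jlogOf_le hC K
    have hlog : Real.log ((K : ℝ) + 1) ≤ (K : ℝ) + 1 - 1 := Real.log_le_sub_one_of_pos (by positivity)
    have h2 : C * Real.log ((K : ℝ) + 1) ≤ C * K := by
      have := mul_le_mul_of_nonneg_left hlog hC; linarith
    have e : (C + 2) * ((K : ℝ) + 1) = C * K + C + 2 * K + 2 := by ring
    rw [e]; linarith
  have hpow : ((K : ℝ) + 1) ^ (C * Real.log Λ) ≤ ((K : ℝ) + 1) ^ (⌈C * Real.log Λ⌉₊ : ℕ) := by
    calc ((K : ℝ) + 1) ^ (C * Real.log Λ) ≤ ((K : ℝ) + 1) ^ ((⌈C * Real.log Λ⌉₊ : ℕ) : ℝ) :=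
          Real.rpow_le_rpow_of_exponent_le hK1 (Nat.le_ceil _)
      _ = ((K : ℝ) + 1) ^ (⌈C * Real.log Λ⌉₊ : ℕ) := Real.rpow_natCast _ _
  calc windowSum 1 Λ (jlogOf C K) K
      ≤ (((K - jlogOf C K : ℕ) : ℝ) + 1) * ((1 : ℝ) ^ jlogOf C K * Λ ^ (K - jlogOf C K)) :=
        windowSum_le_length zero_le_one le_rfl hΛ (jlogOf_le C K)
    _ ≤ ((C + 2) * ((K : ℝ) + 1)) * (1 * (Λ * ((K : ℝ) + 1) ^ (⌈C * Real.log Λ⌉₊ : ℕ))) := by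
        refine mul_le_mul hlen ?_ (by positivity) (by positivity)
        rw [one_pow]
        exact mul_le_mul_of_nonneg_left
          (le_trans (pow_logWindow_le hΛ hC K) (mul_le_mul_of_nonneg_left hpow hΛ0.le)) zero_le_one
    _ = (C + 2) * Λ * ((K : ℝ) + 1) ^ (⌈C * Real.log Λ⌉₊ + 1) := by ring

/-- THE LOG-WINDOW θ-SUM IS SUMMABLE FOR EVERY `θ < 1` (no condition linking `θ` and `Λ`): it is `poly(K)·θ^K`.
[folklore] -/
theorem summable_windowSum_log {θ Λ C : ℝ} (hθ : 0 < θ) (hθ1 : θ < 1) (hΛ : 1 ≤ Λ) (hC : 0 ≤ C) :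
    Summable (fun K => windowSum θ Λ (jlogOf C K) K) := by
  have hΛ0 : 0 < Λ := lt_of_lt_of_le one_pos hΛ
  set N : ℕ := ⌈C * Real.log θ⁻¹ + C * Real.log Λ⌉₊ with hN
  set A : ℝ := (C + 2) * (θ⁻¹ * Λ) with hA
  have hmaj : Summable (fun K : ℕ => A * (((K : ℝ) + 1) ^ (N + 1) * θ ^ K)) :=
    (T4CauchySum.summable_succ_pow_mul_geometric hθ.le hθ1 (N + 1)).mul_left A
  refine Summable.of_nonneg_of_le (fun K => windowSum_nonneg hθ.le hΛ0.le _ _) (fun K => ?_) hmaj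
  have hK0 : (0 : ℝ) ≤ (K : ℝ) := Nat.cast_nonneg K
  have hK1 : (1 : ℝ) ≤ (K : ℝ) + 1 := by linarith
  have hKp : (0 : ℝ) < (K : ℝ) + 1 := by positivity
  have hlen : (((K - jlogOf C K : ℕ) : ℝ) + 1) ≤ (C + 2) * ((K : ℝ) + 1) := by
    have h1 := sub_jlogOf_le hC K
    have hlog : Real.log ((K : ℝ) + 1) ≤ (K : ℝ) + 1 - 1 := Real.log_le_sub_one_of_pos hKp
    have h2 : C * Real.log ((K : ℝ) + 1) ≤ C * K := by
      have := mul_le_mul_of_nonneg_left hlog hC; linarith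
    have e : (C + 2) * ((K : ℝ) + 1) = C * K + C + 2 * K + 2 := by ring
    rw [e]; linarith
  have hprod : ((K : ℝ) + 1) ^ (C * Real.log θ⁻¹) * ((K : ℝ) + 1) ^ (C * Real.log Λ) ≤ ((K : ℝ) + 1) ^ N := by
    rw [← Real.rpow_add hKp]
    calc ((K : ℝ) + 1) ^ (C * Real.log θ⁻¹ + C * Real.log Λ) ≤ ((K : ℝ) + 1) ^ ((N : ℕ) : ℝ) :=
          Real.rpow_le_rpow_of_exponent_le hK1 (by rw [hN]; exact Nat.le_ceil _)
      _ = ((K : ℝ) + 1) ^ N := Real.rpow_natCast _ _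
  have hθK : 0 ≤ θ ^ K := pow_nonneg hθ.le K
  calc windowSum θ Λ (jlogOf C K) K
      ≤ (((K - jlogOf C K : ℕ) : ℝ) + 1) * (θ ^ jlogOf C K * Λ ^ (K - jlogOf C K)) :=
        windowSum_le_length hθ.le hθ1.le hΛ (jlogOf_le C K)
    _ ≤ ((C + 2) * ((K : ℝ) + 1)) *
          ((θ ^ K * (θ⁻¹ * ((K : ℝ) + 1) ^ (C * Real.log θ⁻¹))) * (Λ * ((K : ℝ) + 1) ^ (C * Real.log Λ))) :=
        mul_le_mul hlen (mul_le_mul (pow_logCut_le hθ hθ1.le hC K) (pow_logWindow_le hΛ hC K)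
          (by positivity) (by positivity)) (by positivity) (by positivity)
    _ = A * (((K : ℝ) + 1) * (((K : ℝ) + 1) ^ (C * Real.log θ⁻¹) * ((K : ℝ) + 1) ^ (C * Real.log Λ)) * θ ^ K) := by
        rw [hA]; ring
    _ ≤ A * (((K : ℝ) + 1) * ((K : ℝ) + 1) ^ N * θ ^ K) := by
        have hA0 : 0 ≤ A := by rw [hA]; positivity
        exact mul_le_mul_of_nonneg_left (mul_le_mul_of_nonneg_right
          (mul_le_mul_of_nonneg_left hprod hKp.le) hθK) hA0
    _ = A * (((K : ℝ) + 1) ^ (N + 1) * θ ^ K) := by ring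

/-- THE BAD-CLASS WEIGHT UNDER THE LOG CUT: `Σ_K V·r^{K − jlog(K)} < ∞` once `C·(−log r) > 1` — a p-series plus a
geometric series (compare `T4WeightBudget.summable_weightMajorant`, which asks for a LINEAR window `c·K ≤ K − j⋆(K)`).
[folklore] -/
theorem summable_weightMajorant_log {r V C : ℝ} (h0 : 0 < r) (h1 : r < 1) (hV : 0 ≤ V)
    (hC : 1 < C * (-Real.log r)) : Summable (fun K => V * r ^ (K - jlogOf C K)) := by
  have hp : C * Real.log r < -1 := by
    have e : C * Real.log r = -(C * -Real.log r) := by ring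
    rw [e]; linarith
  have hgeo : Summable (fun K : ℕ => r ^ K) := summable_geometric_of_lt_one h0.le h1
  have hps : Summable (fun K : ℕ => ((K : ℝ) + 1) ^ (C * Real.log r)) := by
    have := (summable_nat_add_iff 1).mpr (Real.summable_nat_rpow.mpr hp)
    refine this.congr fun K => ?_
    push_cast; rfl
  have hmaj : Summable (fun K : ℕ => V * (r ^ K + ((K : ℝ) + 1) ^ (C * Real.log r))) := (hgeo.add hps).mul_left V
  refine Summable.of_nonneg_of_le (fun K => mul_nonneg hV (pow_nonneg h0.le _)) (fun K => ?_) hmaj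
  refine mul_le_mul_of_nonneg_left ?_ hV
  have hK : (0 : ℝ) < (K : ℝ) + 1 := by positivity
  have hmin := min_le_sub_jlogOf C K
  have key : r ^ (K - jlogOf C K) ≤ r ^ (min (K : ℝ) (C * Real.log ((K : ℝ) + 1))) := by
    rw [← Real.rpow_natCast r (K - jlogOf C K)]
    exact Real.rpow_le_rpow_of_exponent_ge h0 h1.le hmin
  rcases min_choice (K : ℝ) (C * Real.log ((K : ℝ) + 1)) with h | h <;> rw [h] at key
  · rw [Real.rpow_natCast] at key
    exact le_trans key (le_add_of_nonneg_right (Real.rpow_nonneg hK.le _))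
  · rw [rpow_log_swap h0] at key
    exact le_trans key (le_add_of_nonneg_left (pow_nonneg h0.le _))

/-- A per-cube discrepancy that is only POLYNOMIALLY small, `d_K ≤ D·(K+1)^{−q}`, trivially counted on the log window, is
summable as soon as `q ≥ ⌈C·log Λ⌉ + 3` (record §R3: the R-type response of old slices near recent large fields,
`q = κ₀/2` up to constants — hence `κ₀` large; Bałaban's `κ₀ ≧ 7`, (2.46) p. 263, is a free order of perturbation
expansion). [folklore] -/
theorem summable_polyRate_logWindow {Λ C D q : ℝ} (hΛ : 1 ≤ Λ) (hC : 0 ≤ C) (hD : 0 ≤ D) {d : ℕ → ℝ}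
    (hd0 : ∀ K, 0 ≤ d K) (hd : ∀ K, d K ≤ D * ((K : ℝ) + 1) ^ (-q))
    (hq : ((⌈C * Real.log Λ⌉₊ : ℕ) : ℝ) + 3 ≤ q) :
    Summable (fun K => d K * windowSum 1 Λ (jlogOf C K) K) := by
  have hΛ0 : 0 < Λ := lt_of_lt_of_le one_pos hΛ
  set N : ℕ := ⌈C * Real.log Λ⌉₊ with hN
  have hps : Summable (fun K : ℕ => ((K : ℝ) + 1) ^ (-2 : ℝ)) := by
    have := (summable_nat_add_iff 1).mpr (Real.summable_nat_rpow.mpr (by norm_num : (-2 : ℝ) < -1))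
    refine this.congr fun K => ?_
    push_cast; rfl
  have hmaj : Summable (fun K : ℕ => D * ((C + 2) * Λ) * ((K : ℝ) + 1) ^ (-2 : ℝ)) := hps.mul_left _
  refine Summable.of_nonneg_of_le (fun K => mul_nonneg (hd0 K) (windowSum_nonneg zero_le_one hΛ0.le _ _))
    (fun K => ?_) hmaj
  have hKp : (0 : ℝ) < (K : ℝ) + 1 := by positivity
  have hK1 : (1 : ℝ) ≤ (K : ℝ) + 1 := by have := (Nat.cast_nonneg K : (0 : ℝ) ≤ K); linarith
  have hexp : ((K : ℝ) + 1) ^ (-q) * ((K : ℝ) + 1) ^ (N + 1) ≤ ((K : ℝ) + 1) ^ (-2 : ℝ) := by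
    rw [← Real.rpow_natCast _ (N + 1), ← Real.rpow_add hKp]
    refine Real.rpow_le_rpow_of_exponent_le hK1 ?_
    push_cast; linarith
  calc d K * windowSum 1 Λ (jlogOf C K) K
      ≤ (D * ((K : ℝ) + 1) ^ (-q)) * ((C + 2) * Λ * ((K : ℝ) + 1) ^ (N + 1)) :=
        mul_le_mul (hd K) (windowCount_log_le hΛ hC K) (windowSum_nonneg zero_le_one hΛ0.le _ _) (by positivity)
    _ = D * ((C + 2) * Λ) * (((K : ℝ) + 1) ^ (-q) * ((K : ℝ) + 1) ^ (N + 1)) := by ring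
    _ ≤ D * ((C + 2) * Λ) * ((K : ℝ) + 1) ^ (-2 : ℝ) :=
        mul_le_mul_of_nonneg_left hexp (by positivity)

/-! ## §4 The boundary pieces: the (α-B) hypothesis of row T4-U3.B, consumed BY NAME

`T4RecentScale.Kind.boundary` factors (the terms `𝐁^{(j)}(X, …)` of (2.40)–(2.42) p. 261 and the new boundary terms
`𝐁′^{(k)}(X)` of (1.98)–(1.101) p. 390, both analytic on `Ũ^c(X, α̃₀, α̃₁)` and exponentially small in `d(X)`) are
matched at the RECENT profile with kind constant `C_B` — this is row T4-U3.B's deliverable (cell NE5-B ⊂ NE5, NOT PRINTED;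
tree `T4BoundaryCarrier`, p180947: `T4BoundaryCarrier.factorLogRatio_boundary` produces exactly this `FactorLogRatio` on
the index set `Adm ×ˢ admFl` with `c ≡ 0` — B-pieces carry NO vacuum-energy subtraction, so the boundary kind contributes
nothing to the common-constant budget of §3 — and `δ ≡ 0`; `boundaryRate_of_factorLogRatio` is the by-name adapter and
`injectedRate_zero` the trivial discrepancy instance) and enters here as the hypothesis `BoundaryRate`; nothing about it is
proved, and this module does not import the carrier (the adapter is stated over `T4RecentScale` only). -/

/-- HYPOTHESIS SHAPE `BoundaryRate` (row T4-U3.B, variant (α): a RATE for the boundary pieces; NOT PRINTED): the node-U5b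
statement `T4RecentScale.FactorLogRatio` for a family all of kind `boundary`, kind constant `C_B`. [cite:
Balaban1988Convergent, (2.41)–(2.42) p.261; Balaban1989LargeFieldII, (1.99) p.390 — the one-run SIZE inputs only] -/
def BoundaryRate {ι V : Type*} (Adm : Set V) (facB : Finset ι) (sc : ι → ℕ) (w : ι → ℝ) (fA fB : ι → V → ℝ)
    (c : ι → ℝ) (CB θ : ℝ) (δ : ℕ → ℝ) : Prop :=
  T4RecentScale.FactorLogRatio Adm facB (fun _ => T4RecentScale.Kind.boundary) sc w fA fB c (fun _ => CB) θ δ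

/-- `BoundaryRate` unfolds to the `FactorLogRatio` of an all-boundary family (by `rfl`). [folklore] -/
theorem boundaryRate_iff {ι V : Type*} {Adm : Set V} {facB : Finset ι} {sc : ι → ℕ} {w : ι → ℝ}
    {fA fB : ι → V → ℝ} {c : ι → ℝ} {CB θ : ℝ} {δ : ℕ → ℝ} :
    BoundaryRate Adm facB sc w fA fB c CB θ δ ↔
      T4RecentScale.FactorLogBound Adm facB fA fB c
        (T4RecentScale.recentProfile (fun _ => T4RecentScale.Kind.boundary) sc w (fun _ => CB) θ δ) :=
  Iff.rfl

/-- BY-NAME ADAPTER: a `FactorLogRatio` for an all-boundary family with ANY kind table `Ck` (the output of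
`T4BoundaryCarrier.factorLogRatio_boundary`, row T4-U3.B) is `BoundaryRate` with `C_B = Ck boundary`. [folklore] -/
theorem boundaryRate_of_factorLogRatio {ι V : Type*} {Adm : Set V} {facB : Finset ι} {sc : ι → ℕ} {w : ι → ℝ}
    {fA fB : ι → V → ℝ} {c : ι → ℝ} {CB θ : ℝ} {δ : ℕ → ℝ} {Ck : T4RecentScale.Kind → ℝ}
    (h : T4RecentScale.FactorLogRatio Adm facB (fun _ => T4RecentScale.Kind.boundary) sc w fA fB c Ck θ δ)
    (hCk : Ck T4RecentScale.Kind.boundary = CB) : BoundaryRate Adm facB sc w fA fB c CB θ δ := by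
  intro v hv i hi
  have h3 := h v hv i hi
  refine ⟨h3.1, h3.2.1, ?_⟩
  have e : T4RecentScale.recentProfile (fun _ => T4RecentScale.Kind.boundary) sc w (fun _ => CB) θ δ i
      = T4RecentScale.recentProfile (fun _ => T4RecentScale.Kind.boundary) sc w Ck θ δ i := by
    simp only [T4RecentScale.recentProfile, hCk]
  rw [e]; exact h3.2.2

/-- With `δ ≡ 0` (the boundary carrier's output) node U2's discrepancy hypothesis holds trivially for any `C ≥ 0`.
[folklore] -/
theorem injectedRate_zero {θ C : ℝ} (hθ : 0 ≤ θ) (hC : 0 ≤ C) : T4CauchySum.InjectedRate C 0 θ (fun _ _ => 0) :=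
  fun K j _ => ⟨le_rfl, show (0 : ℝ) ≤ C * ((K : ℝ) + 1) ^ 0 * θ ^ j by positivity⟩

/-- **THE BOUNDARY GROUP'S BUDGET**: under `BoundaryRate` at cutoff `K`, with recent-only boundary pieces and window
multiplicity, on the admissible set `|log ∏ f^B − log ∏ f^A − Σ c_i| ≤ C_B(1 + C_δ)·(Cw·vol)·windowSum θ Λ j⋆ K`.
[folklore] -/
theorem boundary_log_prod_le {ι V : Type*} {Adm : Set V} {facB : Finset ι} {sc : ι → ℕ} {w : ι → ℝ}
    {fA fB : ι → V → ℝ} {c : ι → ℝ} {CB θ Cδ Cw vol Λ : ℝ} {δ : ℕ → ℕ → ℝ} {jstar K : ℕ}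
    (hB : BoundaryRate Adm facB sc w fA fB c CB θ (δ K)) (hδ : T4CauchySum.InjectedRate Cδ 0 θ δ) (hCB : 0 ≤ CB)
    (hCδ : 0 ≤ Cδ) (hθ : 0 ≤ θ) (hw : ∀ i ∈ facB, 0 ≤ w i) (hrec : RecentOnly facB sc jstar K)
    (hM : WindowMultiplicity facB sc w Cw vol Λ jstar K) :
    ∀ v ∈ Adm, |Real.log (∏ i ∈ facB, fB i v) - Real.log (∏ i ∈ facB, fA i v) - ∑ i ∈ facB, c i|
      ≤ CB * (1 + Cδ) * (Cw * vol) * windowSum θ Λ jstar K := by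
  have hB' : T4RecentScale.FactorLogBound Adm facB fA fB c
      (T4RecentScale.recentProfile (fun _ => T4RecentScale.Kind.boundary) sc w (fun _ => CB) θ (δ K)) := hB
  intro v hv
  refine (hB'.log_prod v hv).trans ?_
  calc ∑ i ∈ facB, T4RecentScale.recentProfile (fun _ => T4RecentScale.Kind.boundary) sc w (fun _ => CB) θ (δ K) i
      ≤ ∑ i ∈ facB, CB * (1 + Cδ) * θ ^ sc i * w i := Finset.sum_le_sum fun i hi =>
        T4RecentScale.recentProfile_le_rate (kind := fun _ => T4RecentScale.Kind.boundary) (Ck := fun _ => CB)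
          hδ (hrec i hi).2 hCB (hw i hi)
    _ ≤ CB * (1 + Cδ) * (Cw * vol) * windowSum θ Λ jstar K :=
        sum_rate_le_windowSum (mul_nonneg hCB (by linarith)) hθ hrec hM

/-! ## §5 Markov caps on history functionals (located repair, record §R)

A per-term budget proportional to the term's recent pending large-field volume (the `n < k` parts of (2.43)/(2.44)) is
NOT uniformly small on a class defined only by "no OLD pending structure": per term the volume is bounded only by counting.
The repair typed here: ALSO exclude the terms where a nonnegative history functional `V` (an age-weighted pending volume)
exceeds `vol·v_K`; the excluded class has relative weight `≤ ν_K/v_K` under the FIRST-MOMENT hypothesis `Σ_τ V_τ a_τ ≤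
vol·ν_K·Σ_τ a_τ` (cell NE7b′, NOT PRINTED — a relative-weight statement of the kind of `T4WeightBudget.RelWeightBound`),
and on the kept class `V_τ < vol·v_K` is the uniform budget.  Choosing `v_K = √ν_K` makes both `Σ_K v_K` and `Σ_K ν_K/v_K`
finite when `Σ √ν_K < ∞`. [folklore] -/

/-- MARKOV'S INEQUALITY for a finite nonnegative family. [folklore] -/
theorem markov_filter {ι : Type*} (T : Finset ι) {a V : ι → ℝ} {lam : ℝ} (ha : ∀ τ ∈ T, 0 ≤ a τ)
    (hV : ∀ τ ∈ T, 0 ≤ V τ) (hlam : 0 < lam) :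
    ∑ τ ∈ T with lam ≤ V τ, a τ ≤ lam⁻¹ * ∑ τ ∈ T, V τ * a τ := by
  rw [← div_eq_inv_mul, le_div_iff₀ hlam, Finset.sum_mul]
  calc ∑ τ ∈ T with lam ≤ V τ, a τ * lam ≤ ∑ τ ∈ T with lam ≤ V τ, V τ * a τ :=
        Finset.sum_le_sum fun τ hτ => by
          rw [mul_comm]
          exact mul_le_mul_of_nonneg_right (Finset.mem_filter.mp hτ).2 (ha τ (Finset.mem_filter.mp hτ).1)
    _ ≤ ∑ τ ∈ T, V τ * a τ :=
        Finset.sum_le_sum_of_subset_of_nonneg (Finset.filter_subset _ _)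
          fun τ hτ _ => mul_nonneg (hV τ hτ) (ha τ hτ)

/-- HYPOTHESIS SHAPE — FIRST MOMENT OF A HISTORY FUNCTIONAL (cell NE7b′, NOT PRINTED): `Σ_τ V_τ a_τ ≤ vol·ν·Σ_τ a_τ`.
[folklore] (a definition) -/
def FirstMoment {ι : Type*} (T : Finset ι) (a V : ι → ℝ) (vol ν : ℝ) : Prop :=
  ∑ τ ∈ T, V τ * a τ ≤ vol * ν * ∑ τ ∈ T, a τ

/-- **THE CAP'S RELATIVE WEIGHT**: under `FirstMoment`, the terms with `V_τ ≥ vol·v` weigh at most `(ν/v)·Σ_τ a_τ`.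
[folklore] -/
theorem capWeight_le {ι : Type*} {T : Finset ι} {a V : ι → ℝ} {vol ν v : ℝ} (ha : ∀ τ ∈ T, 0 ≤ a τ)
    (hV : ∀ τ ∈ T, 0 ≤ V τ) (hvol : 0 < vol) (hv : 0 < v) (h : FirstMoment T a V vol ν) :
    ∑ τ ∈ T with vol * v ≤ V τ, a τ ≤ (ν / v) * ∑ τ ∈ T, a τ := by
  have hlam : 0 < vol * v := mul_pos hvol hv
  have key : (vol * v)⁻¹ * (vol * ν * ∑ τ ∈ T, a τ) = (ν / v) * ∑ τ ∈ T, a τ := by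
    field_simp
  calc ∑ τ ∈ T with vol * v ≤ V τ, a τ ≤ (vol * v)⁻¹ * ∑ τ ∈ T, V τ * a τ := markov_filter T ha hV hlam
    _ ≤ (vol * v)⁻¹ * (vol * ν * ∑ τ ∈ T, a τ) := mul_le_mul_of_nonneg_left h (inv_nonneg.mpr hlam.le)
    _ = (ν / v) * ∑ τ ∈ T, a τ := key

/-- On the KEPT class the functional is uniformly below the cap. [folklore] -/
theorem lt_cap_of_not_mem {ι : Type*} {T : Finset ι} {V : ι → ℝ} {vol v : ℝ} {τ : ι} (hτ : τ ∈ T)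
    (hkept : τ ∉ T.filter (fun τ => vol * v ≤ V τ)) : V τ < vol * v := by
  by_contra hge
  exact hkept (Finset.mem_filter.mpr ⟨hτ, not_lt.mp hge⟩)

/-- The square-root threshold: `v_K = √ν_K` gives `ν_K / v_K = √ν_K` (`0 < ν_K`). [folklore] -/
theorem div_sqrt_self {ν : ℝ} (hν : 0 < ν) : ν / Real.sqrt ν = Real.sqrt ν := by
  rw [div_eq_iff (Real.sqrt_pos.mpr hν).ne', Real.mul_self_sqrt hν.le]

/-! ## §6 Assembly: the literal `hgood` clause of `T4WeightBudget.hybridSandwich_of_relWeightBound` -/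

/-- THE OUTPUT SHAPE OF ROW T4-U5.E-b: literally the `hgood` binder of `T4WeightBudget.hybridSandwich_of_relWeightBound` /
`cauchy_of_relWeightBound` — per cutoff ONE constant `c`, t-independent, and the sandwich with radius `vol·δ_K` for every
good term at every `|t| ≤ l₀`. [folklore] (a definition; the clause is cell NE7's good-class half, NOT PRINTED) -/
def GoodClause {ι : Type*} [DecidableEq ι] (l₀ vol : ℝ) (T : ℕ → Finset ι) (A B : ℕ → ℝ → ι → ℝ)
    (Bad : ℕ → ℝ → Finset ι) (δ : ℕ → ℝ) : Prop :=
  ∀ K : ℕ, ∃ c : ℝ, ∀ t : ℝ, |t| ≤ l₀ → ∀ τ ∈ T K \ Bad K t,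
    Real.exp (c - vol * δ K) * A K t τ ≤ B K t τ ∧ B K t τ ≤ Real.exp (c + vol * δ K) * A K t τ

/-- HYPOTHESIS SHAPE — THE PER-TERM BUDGET of nodes U5/U5b on the good class (cell NEW ESTIMATES, NOT PRINTED): every good
term is sandwiched with ITS OWN constant `Cc K t τ` and remainder `Rr K t τ` (`T4RecentScale.goodTerm_sandwich`), the
remainder is budgeted per unit volume, `Rr ≤ vol·r_K` (§1–§2, §4, §5), and the constant deviates from a t-INDEPENDENT class
constant `c₀ K` by at most `vol·s_K` (§3; t-independence = hazard H-U5b-1′, structural). [folklore] (a definition; the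
budget it names is NOT PRINTED) -/
structure TermBudget {ι : Type*} [DecidableEq ι] (l₀ vol : ℝ) (T : ℕ → Finset ι) (A B : ℕ → ℝ → ι → ℝ)
    (Bad : ℕ → ℝ → Finset ι) (Cc Rr : ℕ → ℝ → ι → ℝ) (c₀ r s : ℕ → ℝ) : Prop where
  nonneg : ∀ K t, |t| ≤ l₀ → ∀ τ ∈ T K \ Bad K t, 0 ≤ A K t τ
  lower : ∀ K t, |t| ≤ l₀ → ∀ τ ∈ T K \ Bad K t, Real.exp (Cc K t τ - Rr K t τ) * A K t τ ≤ B K t τ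
  upper : ∀ K t, |t| ≤ l₀ → ∀ τ ∈ T K \ Bad K t, B K t τ ≤ Real.exp (Cc K t τ + Rr K t τ) * A K t τ
  remainder : ∀ K t, |t| ≤ l₀ → ∀ τ ∈ T K \ Bad K t, Rr K t τ ≤ vol * r K
  deviation : ∀ K t, |t| ≤ l₀ → ∀ τ ∈ T K \ Bad K t, |Cc K t τ - c₀ K| ≤ vol * s K

/-- **ROW T4-U5.E-b, KERNEL PART**: a per-term budget gives the `hgood` clause with `δ_K = r_K + s_K` and the class
constant `c₀ K`. [folklore] -/
theorem goodClause_of_termBudget {ι : Type*} [DecidableEq ι] {l₀ vol : ℝ} {T : ℕ → Finset ι}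
    {A B : ℕ → ℝ → ι → ℝ} {Bad : ℕ → ℝ → Finset ι} {Cc Rr : ℕ → ℝ → ι → ℝ} {c₀ r s : ℕ → ℝ}
    (h : TermBudget l₀ vol T A B Bad Cc Rr c₀ r s) : GoodClause l₀ vol T A B Bad (fun K => r K + s K) := by
  intro K
  refine ⟨c₀ K, fun t ht τ hτ => ?_⟩
  have ha := h.nonneg K t ht τ hτ
  have hD := abs_le.mp (h.deviation K t ht τ hτ)
  have hR := h.remainder K t ht τ hτ
  have hlo : c₀ K - vol * (r K + s K) ≤ Cc K t τ - Rr K t τ := by rw [mul_add]; linarith [hD.1]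
  have hhi : Cc K t τ + Rr K t τ ≤ c₀ K + vol * (r K + s K) := by rw [mul_add]; linarith [hD.2]
  constructor
  · calc Real.exp (c₀ K - vol * (r K + s K)) * A K t τ ≤ Real.exp (Cc K t τ - Rr K t τ) * A K t τ :=
          mul_le_mul_of_nonneg_right (Real.exp_le_exp.mpr hlo) ha
      _ ≤ B K t τ := h.lower K t ht τ hτ
  · calc B K t τ ≤ Real.exp (Cc K t τ + Rr K t τ) * A K t τ := h.upper K t ht τ hτ
      _ ≤ Real.exp (c₀ K + vol * (r K + s K)) * A K t τ :=
          mul_le_mul_of_nonneg_right (Real.exp_le_exp.mpr hhi) ha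

/-- PLUG 1: the good clause is exactly what `T4WeightBudget.hybridSandwich_of_relWeightBound` consumes. [folklore] -/
theorem hybridSandwich_of_goodClause {ι : Type*} [DecidableEq ι] {l₀ vol : ℝ} {T : ℕ → Finset ι}
    {A B : ℕ → ℝ → ι → ℝ} {Bad : ℕ → ℝ → Finset ι} {W δ : ℕ → ℝ}
    (hW : T4WeightBudget.RelWeightBound l₀ T A B Bad W)
    (hA : ∀ K t, |t| ≤ l₀ → ∀ τ ∈ T K, 0 ≤ A K t τ) (hB : ∀ K t, |t| ≤ l₀ → ∀ τ ∈ T K, 0 ≤ B K t τ)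
    (hgood : GoodClause l₀ vol T A B Bad δ) :
    ∀ K : ℕ, ∃ c : ℝ, ∀ t : ℝ, |t| ≤ l₀ →
      ∃ G : Finset ι, HybridSandwich (T K) G (A K t) (B K t) c (vol * δ K) (W K) :=
  T4WeightBudget.hybridSandwich_of_relWeightBound hW hA hB hgood

/-- PLUG 2: with the weight budget (row T4-U5c.E), positivity and `Summable δ`, the good clause gives the cell's T4 Cauchy
conclusion through `T4WeightBudget.cauchy_of_relWeightBound`. [folklore] -/
theorem cauchy_of_goodClause {ι : Type*} [DecidableEq ι] {l₀ vol : ℝ} {T : ℕ → Finset ι}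
    {A B : ℕ → ℝ → ι → ℝ} {Bad : ℕ → ℝ → Finset ι} {W δ : ℕ → ℝ} {Z : ℕ → ℝ → ℝ} (hvol : 0 < vol) (hl₀ : 0 ≤ l₀)
    (hW : T4WeightBudget.RelWeightBound l₀ T A B Bad W)
    (hZA : ∀ K t, |t| ≤ l₀ → Z K t = ∑ τ ∈ T K, A K t τ)
    (hZB : ∀ K t, |t| ≤ l₀ → Z (K + 1) t = ∑ τ ∈ T K, B K t τ)
    (hA : ∀ K t, |t| ≤ l₀ → ∀ τ ∈ T K, 0 ≤ A K t τ) (hB : ∀ K t, |t| ≤ l₀ → ∀ τ ∈ T K, 0 ≤ B K t τ)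
    (hpos : ∀ K t, |t| ≤ l₀ → 0 < ∑ τ ∈ T K, A K t τ) (hδ : Summable δ) (hgood : GoodClause l₀ vol T A B Bad δ) :
    MatchingModConstants vol l₀ (hybridDelta vol δ W) Z ∧
      Summable (hybridDelta vol δ W) ∧
      (∀ t : ℝ, |t| ≤ l₀ → CauchySeq fun K => genFun Z K t) ∧
      TendstoUniformlyOn (fun K t => genFun Z K t) (genFunLim Z) atTop {t | |t| ≤ l₀} :=
  T4WeightBudget.cauchy_of_relWeightBound hvol hl₀ hW hZA hZB hA hB hpos hδ hgood

/-- PLUG 3 (decision D10, row T4-U5b.E2: the indicator shell): the `hcore` binder of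
`T4IndicatorShell.cauchy_of_relWeightBound_shell` is LITERALLY the good clause for the core pieces `A − shA`, `B − shB`.
[folklore] -/
theorem cauchy_of_goodClause_shell {ι : Type*} [DecidableEq ι] {l₀ vol : ℝ} {T : ℕ → Finset ι}
    {A B shA shB : ℕ → ℝ → ι → ℝ} {Bad : ℕ → ℝ → Finset ι} {W Wsh δ : ℕ → ℝ} {Z : ℕ → ℝ → ℝ} (hvol : 0 < vol)
    (hl₀ : 0 ≤ l₀) (hW : T4WeightBudget.RelWeightBound l₀ T A B Bad W)
    (hSh : T4IndicatorShell.ShellWeightBound l₀ T A B shA shB Wsh) (hlt : ∀ K, W K + Wsh K < 1)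
    (hZA : ∀ K t, |t| ≤ l₀ → Z K t = ∑ τ ∈ T K, A K t τ)
    (hZB : ∀ K t, |t| ≤ l₀ → Z (K + 1) t = ∑ τ ∈ T K, B K t τ)
    (hpos : ∀ K t, |t| ≤ l₀ → 0 < ∑ τ ∈ T K, A K t τ) (hδ : Summable δ)
    (hcore : GoodClause l₀ vol T (fun K t τ => A K t τ - shA K t τ) (fun K t τ => B K t τ - shB K t τ) Bad δ) :
    MatchingModConstants vol l₀ (hybridDelta vol δ (fun K => W K + Wsh K)) Z ∧
      Summable (hybridDelta vol δ (fun K => W K + Wsh K)) ∧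
      (∀ t : ℝ, |t| ≤ l₀ → CauchySeq fun K => genFun Z K t) ∧
      TendstoUniformlyOn (fun K t => genFun Z K t) (genFunLim Z) atTop {t | |t| ≤ l₀} :=
  T4IndicatorShell.cauchy_of_relWeightBound_shell hvol hl₀ hW hSh hlt hZA hZB hpos hδ hcore

/-- **`Summable δ` FOR THE ROW'S BUDGET**: the crossover majorant with the window sum (times any constant `CO`, collecting
the common-constant budget of §3, the boundary group of §4 and the other rate-only recent kinds) in its `w`-slot is summable
— `T4Crossover.summable_crossoverDelta` + `summable_windowSum`. [folklore] -/
theorem summable_budgetDelta {E a θ Λ b β' R₁ C CO σ : ℝ} {κ₀ : ℕ} {g : ℕ → ℝ} {gs : ℕ → ℕ → ℝ} {jstar : ℕ → ℕ}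
    (ha0 : 0 < a) (ha1 : a < 1) (hθ : 0 < θ) (hθ1 : θ < 1) (hθΛ : θ ≤ Λ) (hb : 0 < b)
    (h031 : ∀ K, Step.Discrete031 b β' K (g K) (gs K)) (hgs : ∀ K k, k ≤ K → 0 ≤ gs K k) (hR₁ : 0 ≤ R₁)
    (hC : 0 ≤ C) (hκ : 4 < κ₀) (hq : θ * (Λ / θ) ^ σ < 1)
    (hwin : ∀ K : ℕ, ((K - jstar K : ℕ) : ℝ) ≤ σ * K + 1) :
    Summable (crossoverDelta E a θ Λ R₁ C κ₀ gs (fun K => CO * windowSum θ Λ (jstar K) K)) :=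
  T4Crossover.summable_crossoverDelta ha0 ha1 hθ hθ1 hθΛ hb h031 hgs hR₁ hC hκ
    ((summable_windowSum hθ hθΛ hq hwin).mul_left CO)

/-- The general additive form: any finitely many summable budget sequences add (`r_K + s_K` of `goodClause_of_termBudget`,
plus cap thresholds `v_K` of §5). [folklore] -/
theorem summable_budget_add {r s v : ℕ → ℝ} (hr : Summable r) (hs : Summable s) (hv : Summable v) :
    Summable (fun K => r K + s K + v K) :=
  (hr.add hs).add hv

end Literature.MathematicalPhysics.QuantumFieldTheory.Balaban1983to89.T4GoodClassBudget
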